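import Mathlib
import Mathlib.RingTheory.Ideal.Height
import Mathlib.RingTheory.Ideal.KrullsHeightTheorem
import Mathlib.RingTheory.Ideal.MinimalPrime.Basic
import Mathlib.RingTheory.KrullDimension.Basic
import Literature.RingTheory.TightClosure.TightClosure
import Mathlib.RingTheory.Regular.RegularSequence
import Mathlib.RingTheory.KrullDimension.Regular
import Mathlib.RingTheory.KrullDimension.NonZeroDivisors
import Mathlib.Order.KrullDimension
import Literature.AlgebraicGeometry.Resolution.CohenMacaulayAvoidance
import Mathlib.RingTheory.Regular.Flat
import Mathlib.RingTheory.Localization.AtPrime.Basic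
import Mathlib.RingTheory.Localization.Submodule
import Mathlib.Data.List.OfFn
import Literature.LinearAlgebra.Matrix.IntegerLinearSolvability
import Mathlib.RingTheory.Ideal.MinimalPrime.Localization
import Mathlib.RingTheory.Filtration
import Mathlib.RingTheory.LocalRing.RingHom.Basic
import Mathlib.RingTheory.Localization.Ideal
import Mathlib.Algebra.CharP.Lemmas
import Literature.RingTheory.TightClosure.CMFILocalizes
import HarnessLib

/-!
# Hashimoto 2010 Cor. 4.7 (CMFI localizes), ideal-theoretic proof — `Hashimoto2010_cmfiLocalizes` HOLDS (re-homed proofs)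

**Hashimoto 2010 Cor. 4.7 («CMFI localizes») — the named fact `Literature.RingTheory.TightClosure.Hashimoto2010_cmfiLocalizes`
(`CMFILocalizes.lean`) HOLDS, at every universe**: for a Noetherian local ring `R` of prime characteristic `p`, if every system of
parameters of `R` is a weakly regular sequence and every parameter ideal of `R` is Frobenius closed (CMFI in the clause form of
Hashimoto 2010 Lemma 4.1), then the same holds for `R_P` at every prime `P` (M. Hashimoto, *F-pure homomorphisms, strong
F-regularity, and F-injectivity*, Comm. Algebra 38 (2010) 4569–4596, arXiv:0908.2703, §4 Cor. 4.7: «Let (R, 𝔪) be a noetherian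
local CMFI ring of characteristic p. Then for any prime ideal P of R, R_P is CMFI.» and Lemma 4.1, read in the held arXiv text
[Hashimoto2010]).  The in-tree proof is IDEAL-THEORETIC (not Hashimoto's Γ-construction / openness of the CMFI locus, not local
cohomology): a prime of height `h` is minimal over the head of a system of parameters (prime avoidance; Matsumura Thm. 14.1);
Cohen–Macaulayness in s.o.p. form localizes (Matsumura Thms. 17.3–17.4 [Matsumura1987]); colon capturing, power lift and
one-generator exchange for Frobenius closed parameter ideals (Fedder–Watanabe 1989, proof of Prop. 2.2 [FedderWatanabe1989]);
one Frobenius closed parameter ideal of a Cohen–Macaulay local ring makes all of them so (Fedder 1983 Thm. 1.12 [Fedder1983];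
Quy–Shimomoto 2017 §3 [QuyShimomoto2017]); initial segments of systems of parameters (Krull intersection); Frobenius-closedness
passes to `R_P`; assembly `clause_localization`; the discharge.  RE-HOMED into `Literature/` by the Hodge foundations lane
(`lit-hodgefound`, seat p20, generation 37): verbatim DECLARATION-LEVEL ports (the declarations needed, in dependency order, each
Part with a route-neutralised module docstring; ring binders `(R : Type)` of the in-tree statements generalised to `(R : Type uR)`,
proofs unchanged) of `Summits/ResolutionOfSingularities/ResolutionOfSingularities/Theorems/FrobeniusLadder{FInjectiveMacaulayfication
SopThroughPrime (3 declarations), FRationalModificationSopWeaklyRegular (3), FInjectiveMacaulayficationCmLocalizes (3),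
FRationalModificationExchange (3 of 4), FInjectiveMacaulayficationFedderCriterion (1 of 5), FRationalModificationPowerLift (2 of 4),
FInjectiveMacaulayficationFrobeniusClosedMove (4 of 5), FInjectiveMacaulayficationOneParameterIdeal (7 of 11),
FInjectiveMacaulayficationPartialSop (1 of 2), FInjectiveMacaulayficationFrobeniusClosedLocalizes (5),
FInjectiveMacaulayficationClauseLocalizes (2 of 4)}.lean` (the in-tree discharge file `…CMFILocalizesHolds.lean`, universe `0`,
is replaced by the exact-name polymorphic theorem at the end, same proof), namespaces
`Summit.ResolutionOfSingularities.ResolutionOfSingularities.Theorems.{FInjectiveMacaulayfication, FRationalModification}` re-rooted as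
`Literature.RingTheory.TightClosure.{CMFILocalization, ParameterIdealClosure}` (in-tree `stub_…` names kept so that twins share short
names; they are proved theorems).  Built on the tree's Literature layer (`Literature/RingTheory/TightClosure/TightClosure.lean`:
`frobeniusPower`, `IsFrobeniusClosed`, `IsSystemOfParameters`; `Literature/AlgebraicGeometry/Resolution/CohenMacaulayAvoidance.lean`;
`Literature/LinearAlgebra/Matrix/IntegerLinearSolvability.lean`; Mathlib's `RingTheory.Sequence.IsWeaklyRegular`, `Ideal.height`,
`ringKrullDim`).  Theorem-only file: no definition, no new named fact (D-0026); imports Mathlib/Literature only; every declaration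
carries the citation of the printed statement it formalises or serves.  The Summits originals stay in place (transitional
duplication).  WHAT THIS IS NOT: nothing here bears on resolution of singularities; this is commutative algebra of
Frobenius closed parameter ideals.
-/

noncomputable section

universe uR

/-!
## Part 1 — port of `Summits/ResolutionOfSingularities/ResolutionOfSingularities/Theorems/FrobeniusLadderFInjectiveMacaulayficationSopThroughPrime.lean` (3 declarations kept)

# A prime is minimal over the head of a system of parameters

In a Noetherian local ring `(R, 𝔪)` of dimension `d`, every prime `P` of height `h` contains the first `h` members `x` of some
system of parameters `(x, t)` of `R` (in the tree's sense `Literature.RingTheory.TightClosure.IsSystemOfParameters`: `dim R = h + e`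
and `rad (x, t) = 𝔪`) and is a minimal prime of `(x)` (`stub_sopThroughPrime`, historical name kept).  Proof: heights are finite
(Krull), `h = ht P ≤ d`; one PRIME AVOIDANCE step (`exists_mem_le_height_sup_span_singleton`): if every minimal prime of `J` has
height `≥ r` and `r < ht I`, some `y ∈ I` avoids the minimal primes of `J` of height exactly `r`, and every minimal prime of
`J + (y)` has height `≥ r + 1`; iterate (`exists_forall_mem_and_le_height`) `h` times inside `P`, then `e` more times inside `𝔪`.
References: H. Matsumura, *Commutative Ring Theory*, CUP 1986, Thm. 14.1 (proof), Thm. 17.4 [Matsumura1987]; Bruns–Herzog A.2–A.4.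
-/

section Part1

open Literature.RingTheory.TightClosure _root_.IsLocalRing

namespace Literature.RingTheory.TightClosure.CMFILocalization.SopThroughPrime

variable {R : Type*} [CommRing R]

section Noetherian

variable [IsNoetherianRing R]

/-- **The prime avoidance step.** In a Noetherian ring, if `r ≤ ht J` (every minimal prime of `J` has
height `≥ r`) and `r < ht I`, then some `y ∈ I` has `r + 1 ≤ ht (J + (y))`: choose `y` outside the
finitely many minimal primes of `J` of height exactly `r` (none of them contains `I`); a minimal prime
`Q` of `J + (y)` of height `r` would be a minimal prime of `J` of height `r` containing `y`. [cite: Matsumura1987, Thm. 14.1 (proof) and Thm. 17.4 (a prime of height h contains the first h members of a system of parameters; prime avoidance)] -/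
theorem exists_mem_le_height_sup_span_singleton (I J : Ideal R) (r : ℕ)
    (hJ : (r : ℕ∞) ≤ J.height) (hI : (r : ℕ∞) < I.height) :
    ∃ y ∈ I, (r : ℕ∞) + 1 ≤ (J ⊔ Ideal.span {y}).height := by
  -- the minimal primes of `J` of height exactly `r`
  set S : Set (Ideal R) := {K | K ∈ J.minimalPrimes ∧ K.height = r} with hS
  have hSfin : S.Finite := J.finite_minimalPrimes_of_isNoetherianRing.subset fun _ h => h.1
  -- prime avoidance: `I ⊄ ⋃ S`
  have havoid : ¬ ((I : Set R) ⊆ ⋃ K ∈ S, (K : Set R)) := by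
    rw [Ideal.subset_union_prime_finite hSfin I I (fun K hK _ _ => hK.1.1.1)]
    rintro ⟨K, hKS, hle⟩
    have h := hI.trans_le (Ideal.height_mono hle)
    rw [hKS.2] at h
    exact lt_irrefl _ h
  obtain ⟨y, hyI, hy⟩ := Set.not_subset.mp havoid
  have hy' : ∀ K ∈ S, y ∉ K := fun K hK hyK => hy (Set.mem_biUnion hK hyK)
  refine ⟨y, hyI, ?_⟩
  rw [(J ⊔ Ideal.span {y}).height_eq_inf_minimalPrimes]
  refine le_iInf₂ fun Q hQ => ?_
  have hQp : Q.IsPrime := hQ.1.1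
  have hJQ : J ≤ Q := le_sup_left.trans hQ.1.2
  have hyQ : y ∈ Q := hQ.1.2 (Ideal.mem_sup_right (Ideal.mem_span_singleton_self y))
  have hrQ : (r : ℕ∞) ≤ Q.height := hJ.trans (Ideal.height_mono hJQ)
  rcases hrQ.lt_or_eq with hlt | heq
  · exact Order.add_one_le_of_lt hlt
  · -- `ht Q = r`: `Q` is a minimal prime of `J` of height `r` containing `y`
    exact absurd hyQ (hy' Q ⟨Ideal.mem_minimalPrimes_of_height_eq hJQ (heq.ge.trans hJ), heq.symm⟩)

/-- **Iterated prime avoidance.** In a Noetherian ring, if `r ≤ ht J` and `r + e ≤ ht I`, then there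
are `t₁, …, tₑ ∈ I` with `r + e ≤ ht (J + (t₁, …, tₑ))` (induction on `e`, one
`exists_mem_le_height_sup_span_singleton` step at a time). [cite: Matsumura1987, Thm. 14.1 (proof) and Thm. 17.4 (a prime of height h contains the first h members of a system of parameters; prime avoidance)] -/
theorem exists_forall_mem_and_le_height (I J : Ideal R) (r : ℕ) (hJ : (r : ℕ∞) ≤ J.height) :
    ∀ e : ℕ, ((r + e : ℕ) : ℕ∞) ≤ I.height →
      ∃ t : Fin e → R, (∀ j, t j ∈ I) ∧
        ((r + e : ℕ) : ℕ∞) ≤ (J ⊔ Ideal.span (Set.range t)).height := by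
  intro e
  induction e with
  | zero =>
    intro _
    refine ⟨Fin.elim0, fun j => j.elim0, ?_⟩
    rw [Set.range_eq_empty, Ideal.span_empty, sup_bot_eq, Nat.add_zero]
    exact hJ
  | succ e ih =>
    intro hI
    have hlt : ((r + e : ℕ) : ℕ∞) < I.height := by
      refine lt_of_lt_of_le ?_ hI
      exact_mod_cast Nat.lt_succ_self (r + e)
    obtain ⟨t, htI, ht⟩ := ih hlt.le
    obtain ⟨y, hyI, hy⟩ :=
      exists_mem_le_height_sup_span_singleton I (J ⊔ Ideal.span (Set.range t)) (r + e) ht hlt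
    refine ⟨Fin.snoc t y, fun j => ?_, ?_⟩
    · refine Fin.lastCases ?_ (fun j => ?_) j
      · rw [Fin.snoc_last]
        exact hyI
      · rw [Fin.snoc_castSucc]
        exact htI j
    · rw [Fin.range_snoc, Ideal.span_insert, sup_comm (Ideal.span {y}), ← sup_assoc,
        ← add_assoc, Nat.cast_succ]
      exact hy

end Noetherian

/-- **A prime is minimal over the head of a system of parameters.** In a Noetherian local ring `R`,
every prime `P` contains the first `h = ht P` members `x` of some system of parameters
`Fin.append x t` of `R` and is a minimal prime of `(x)`: choose `x₁, x₂, … ∈ P` successively outside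
the minimal primes of height `l` of the ideal generated by the first `l` of them (prime avoidance,
possible while `l < ht P`), then continue inside `𝔪` up to `d = dim R` elements; all minimal primes of
`(x₁, …, x_d)` have height `d`, so it is `𝔪`-primary, and `P ⊇ (x₁, …, x_h)` with
`ht P = h ≤ ht (x₁, …, x_h)` is minimal over it. [cite: Matsumura1987, Thm. 14.1 (proof) and Thm. 17.4 (a prime of height h contains the first h members of a system of parameters; prime avoidance)] -/
theorem stub_sopThroughPrime : ∀ (R : Type uR) [CommRing R] [IsNoetherianRing R] [IsLocalRing R]
    (P : Ideal R) [P.IsPrime], ∃ (h e : ℕ) (x : Fin h → R) (t : Fin e → R),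
      Literature.RingTheory.TightClosure.IsSystemOfParameters (Fin.append x t) ∧ (∀ i, x i ∈ P) ∧
      P ∈ (Ideal.span (Set.range x)).minimalPrimes ∧ P.height = h := by
  intro R _ _ _ P _
  -- finite heights: `h = ht P ≤ ht 𝔪 = dim R = h + e`
  obtain ⟨h, hh⟩ := ENat.ne_top_iff_exists.mp (Ideal.height_ne_top_of_isPrime (I := P))
  obtain ⟨d, hd⟩ :=
    ENat.ne_top_iff_exists.mp (Ideal.height_ne_top_of_isPrime (I := maximalIdeal R))
  have hPm : P ≤ maximalIdeal R := le_maximalIdeal (Ideal.IsPrime.ne_top ‹_›)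
  have hhd : h ≤ d := by
    have hle := Ideal.height_mono hPm
    rw [← hh, ← hd] at hle
    exact_mod_cast hle
  obtain ⟨e, rfl⟩ := Nat.exists_eq_add_of_le hhd
  have hdim : ringKrullDim R = ((h + e : ℕ) : WithBot ℕ∞) := by
    rw [← maximalIdeal_height_eq_ringKrullDim, ← hd]
    rfl
  -- the head `x ⊆ P`: `h` prime avoidance steps inside `P`, starting from `⊥`
  obtain ⟨x, hxP, hx⟩ :=
    exists_forall_mem_and_le_height P ⊥ 0 (by simp) h (by rw [Nat.zero_add, hh])
  rw [Nat.zero_add, bot_sup_eq] at hx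
  have hxle : Ideal.span (Set.range x) ≤ P := Ideal.span_le.mpr (Set.range_subset_iff.mpr hxP)
  have hPmin : P ∈ (Ideal.span (Set.range x)).minimalPrimes :=
    Ideal.mem_minimalPrimes_of_height_eq hxle (hh.ge.trans hx)
  -- the tail `t ⊆ 𝔪`: `e` more prime avoidance steps inside `𝔪`, starting from `(x)`
  obtain ⟨t, htm, ht⟩ :=
    exists_forall_mem_and_le_height (maximalIdeal R) (Ideal.span (Set.range x)) h hx e hd.le
  refine ⟨h, e, x, t, ?_, hxP, hPmin, hh.symm⟩
  -- `(x, t) ≤ 𝔪` has height `≥ h + e = ht 𝔪`, so `𝔪` is minimal over it: a system of parameters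
  rw [isSystemOfParameters_iff_mem_minimalPrimes]
  refine ⟨hdim, ?_⟩
  -- the range of an appended family (`range_fin_append` of `AlterationsEnlargingZ.lean`,
  -- re-proved locally to keep the imports small)
  have range_fin_append' : Set.range (Fin.append x t) = Set.range x ∪ Set.range t := by
    ext a
    constructor
    · rintro ⟨i, rfl⟩
      refine Fin.addCases (fun j => ?_) (fun j => ?_) i
      · exact Or.inl ⟨j, (Fin.append_left x t j).symm⟩
      · exact Or.inr ⟨j, (Fin.append_right x t j).symm⟩
    · rintro (⟨j, rfl⟩ | ⟨j, rfl⟩)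
      · exact ⟨Fin.castAdd e j, Fin.append_left x t j⟩
      · exact ⟨Fin.natAdd h j, Fin.append_right x t j⟩
  rw [range_fin_append', Ideal.span_union]
  refine Ideal.mem_minimalPrimes_of_height_eq ?_ (hd.symm.le.trans ht)
  exact sup_le (hxle.trans hPm) (Ideal.span_le.mpr (Set.range_subset_iff.mpr htm))

end Literature.RingTheory.TightClosure.CMFILocalization.SopThroughPrime

end Part1

/-!
## Part 2 — port of `Summits/ResolutionOfSingularities/ResolutionOfSingularities/Theorems/FrobeniusLadderFRationalModificationSopWeaklyRegular.lean` (3 declarations kept)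

# In a Cohen–Macaulay local ring every system of parameters is a regular sequence

Let `(S, 𝔪)` be a Noetherian local ring which is Cohen–Macaulay in the tree's phrasing: there is an `S`-regular sequence in `𝔪`
of length `dim S` (`Literature/AlgebraicGeometry/Resolution/CohenMacaulayAvoidance.lean`).  Then every system of parameters
`s : Fin n → S` (`n = dim S`, `rad (s) = 𝔪`) is a weakly regular sequence on `S` IN THE GIVEN ORDER (`stub_sopWeaklyRegular`,
historical name kept).  Proof (Matsumura's, by induction on `n`, for all rings at once —
`isWeaklyRegular_ofFn_of_isSystemOfParameters_aux`): for `n + 1` put `x = s 0`, `S̄ = S/(x)`; `dim S̄ ≤ n` by Krull's height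
theorem; every associated prime of `S` has coheight `≥ n + 1` (unmixedness) while a prime containing `x` has coheight `≤ n`
(`coheight_le_ringKrullDim_quotient`), so `x` is a non-zero-divisor; cut down and induct.  No characteristic hypothesis.
Reference: [Matsumura1987, Thm. 17.4 (iii)].
-/

section Part2

-- the summit and its single problem share the name `ResolutionOfSingularities`
namespace Literature.RingTheory.TightClosure.ParameterIdealClosure.SopWeaklyRegular

open _root_.IsLocalRing RingTheory.Sequence Literature.RingTheory.TightClosure
  Literature.AlgebraicGeometry.Resolution
open scoped _root_.Pointwise

universe u

/-- If `I ⊆ 𝔭` then the coheight of the prime `𝔭` in `Spec R` is at most `dim R/I` (chains of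
primes above `𝔭` are chains in `V(I) ≅ Spec R/I`). [cite: Matsumura1987, Thm. 17.4 (iii) (in a Cohen–Macaulay local ring every system of parameters is a regular sequence)] -/
theorem coheight_le_ringKrullDim_quotient {R : Type*} [CommRing R] {I : Ideal R}
    (P : PrimeSpectrum R) (h : I ≤ P.asIdeal) :
    ((Order.coheight P : ℕ∞) : WithBot ℕ∞) ≤ ringKrullDim (R ⧸ I) := by
  rw [Order.coheight_eq_krullDim_Ici, ringKrullDim_quotient]
  exact Order.krullDim_le_of_strictMono
    (fun Q : Set.Ici P => (⟨Q.1, (PrimeSpectrum.mem_zeroLocus _ _).mpr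
      fun r hr => ((PrimeSpectrum.asIdeal_le_asIdeal _ _).mpr Q.2) (h hr)⟩ :
        PrimeSpectrum.zeroLocus (I : Set R)))
    fun _ _ hlt => hlt

/-- **Matsumura Thm. 17.4 (iii), inductive form**: for every Noetherian local ring `S` with an
`S`-regular sequence in `𝔪` of length `dim S`, every system of parameters `s : Fin n → S` is a
weakly regular sequence on `S` (induction on `n`, for all rings at once).
[cite: Matsumura1987, Thm. 17.4 (iii)] -/
theorem isWeaklyRegular_ofFn_of_isSystemOfParameters_aux (n : ℕ) :
    ∀ (S : Type u) [CommRing S] [IsNoetherianRing S] [IsLocalRing S] (rs : List S),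
      IsRegular S rs → (∀ r ∈ rs, r ∈ maximalIdeal S) →
      (rs.length : WithBot ℕ∞) = ringKrullDim S →
      ∀ s : Fin n → S, IsSystemOfParameters s → IsWeaklyRegular S (List.ofFn s) := by
  induction n with
  | zero =>
    intro S _ _ _ _ _ _ _ _ _
    rw [List.ofFn_zero]
    exact IsWeaklyRegular.nil S S
  | succ n ih =>
    intro S _ _ _ rs hrs hmem hdim s hs
    obtain ⟨hd, hrad⟩ := hs
    have hxm : s 0 ∈ maximalIdeal S := by
      rw [← hrad]
      exact Ideal.le_radical (Ideal.subset_span ⟨0, rfl⟩)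
    have hlen : rs.length = n + 1 := by
      rw [hd] at hdim
      exact_mod_cast hdim
    -- (1) the local ring `S̄ = S/(x)`, `x = s 0`, and the images `s̄'` of `s 1, …, s n`
    obtain ⟨hSnt, hSloc⟩ := isLocalRing_quotient_span_singleton hxm
    set Sb := S ⧸ Ideal.span {s 0}
    set mk := Ideal.Quotient.mk (Ideal.span {s 0})
    set s' : Fin n → Sb := fun i => mk (s i.succ)
    have hmap : Ideal.map mk (Ideal.span (Set.range s)) = Ideal.span (Set.range s') := by
      refine le_antisymm ?_ ?_
      · rw [Ideal.map_span, Ideal.span_le]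
        rintro _ ⟨_, ⟨i, rfl⟩, rfl⟩
        refine Fin.cases ?_ (fun j => ?_) i
        · have h0 : mk (s 0) = 0 :=
            Ideal.Quotient.eq_zero_iff_mem.mpr (Ideal.mem_span_singleton_self _)
          rw [h0]
          exact SetLike.mem_coe.mpr (zero_mem _)
        · exact Ideal.subset_span ⟨j, rfl⟩
      · rw [Ideal.span_le]
        rintro _ ⟨j, rfl⟩
        exact Ideal.mem_map_of_mem mk (Ideal.subset_span ⟨j.succ, rfl⟩)
    have hrad' : (Ideal.span (Set.range s')).radical = maximalIdeal Sb := by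
      have hker : RingHom.ker mk ≤ Ideal.span (Set.range s) := by
        rw [Ideal.mk_ker, Ideal.span_singleton_le_iff_mem]
        exact Ideal.subset_span ⟨0, rfl⟩
      rw [← hmap, ← Ideal.map_radical_of_surjective Ideal.Quotient.mk_surjective hker, hrad,
        maximalIdeal_quotient_eq_map (Ideal.span {s 0})]
    -- (2) `dim S̄ ≤ n` (Krull's height theorem: `𝔪̄` is minimal over the `n`-generated `(s̄')`)
    have hmin : maximalIdeal Sb ∈ (Ideal.span (Set.range s')).minimalPrimes := by
      rw [← Ideal.radical_minimalPrimes, hrad', Ideal.minimalPrimes_eq_subsingleton_self]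
      exact Set.mem_singleton _
    obtain ⟨m, hm⟩ := exists_nat_cast_eq_ringKrullDim (R := Sb)
    have hheight : (maximalIdeal Sb).height = m := by
      have h := IsLocalRing.maximalIdeal_height_eq_ringKrullDim (R := Sb)
      rw [hm] at h
      exact_mod_cast h
    have hmn : m ≤ n := by
      have h1 := Ideal.height_le_card_of_mem_minimalPrimes_span (Set.finite_range s') hmin
      rw [hheight] at h1
      have h2 : (Set.range s').ncard ≤ n := by
        rw [← Set.image_univ]
        refine (Set.ncard_image_le Set.finite_univ).trans ?_
        rw [Set.ncard_univ, Nat.card_eq_fintype_card, Fintype.card_fin]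
      exact le_trans (by exact_mod_cast h1) h2
    have hdimle : ringKrullDim Sb ≤ n := by
      rw [hm]
      exact_mod_cast hmn
    -- (3) `x` lies in no associated prime of `S` (unmixedness), hence is a non-zero-divisor
    have hx0 : s 0 ∈ nonZeroDivisors S := by
      by_contra hx0
      have h1 : s 0 ∈ ⋃ p ∈ associatedPrimes S S, (p : Set S) := by
        rw [biUnion_associatedPrimes_eq_compl_nonZeroDivisors]
        exact hx0
      obtain ⟨p, hp, hxp⟩ := Set.mem_iUnion₂.mp h1
      have h2 := length_le_coheight_of_mem_associatedPrimes hrs hmem hp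
      have h3 := coheight_le_ringKrullDim_quotient (I := Ideal.span {s 0})
        ⟨p, IsAssociatedPrime.isPrime hp⟩ ((Ideal.span_singleton_le_iff_mem _).mpr hxp)
      have h4 := ((WithBot.coe_le_coe.mpr h2).trans h3).trans hdimle
      rw [hlen] at h4
      have h5 : n + 1 ≤ n := by exact_mod_cast h4
      omega
    have hxreg : IsSMulRegular S (s 0) :=
      (isRegular_iff_mem_nonZeroDivisors.mpr hx0).left.isSMulRegular
    -- (4) `S̄` is again Cohen–Macaulay, of dimension `n` (cutting down)
    obtain ⟨rs₁, hlen₁, hmem₁, hreg₁⟩ := exists_isRegular_quotSMulTop hrs hmem hxreg hxm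
    obtain ⟨hmem₂, hreg₂⟩ := isRegular_quotient_of_isRegular_quotSMulTop hxm hreg₁ hmem₁
    have hdimSb : ringKrullDim Sb = n := by
      have h1 := ringKrullDim_quotient_span_singleton_succ_eq_ringKrullDim hxreg hxm
      rw [hd, hm] at h1
      have h2 : m + 1 = n + 1 := by exact_mod_cast h1
      rw [hm]
      exact_mod_cast (by omega : m = n)
    have hdim₂ : ((rs₁.map mk).length : WithBot ℕ∞) = ringKrullDim Sb := by
      rw [hdimSb, List.length_map, hlen₁, hlen, Nat.add_sub_cancel]
    -- (5) induction hypothesis for the system of parameters `s̄'` of `S̄`, pulled back to `S`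
    have ih' : IsWeaklyRegular Sb (List.ofFn s') :=
      ih Sb (rs₁.map mk) hreg₂ hmem₂ hdim₂ s' ⟨hdimSb, hrad'⟩
    have hw : IsWeaklyRegular Sb (List.ofFn fun i => s i.succ) := by
      have h := (isWeaklyRegular_map_algebraMap_iff Sb Sb (List.ofFn fun i => s i.succ)).mp
      rw [Ideal.Quotient.algebraMap_eq, List.map_ofFn] at h
      exact h ih'
    have heq : ((s 0) • (⊤ : Submodule S S)) = Ideal.span {s 0} := by
      rw [← Submodule.ideal_span_singleton_smul, smul_eq_mul, Ideal.mul_top]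
    let e : QuotSMulTop (s 0) S ≃ₗ[S] Sb := Submodule.quotEquivOfEq _ _ heq
    have hw' : IsWeaklyRegular (QuotSMulTop (s 0) S) (List.ofFn fun i => s i.succ) :=
      (e.isWeaklyRegular_congr _).mpr hw
    rw [List.ofFn_succ]
    exact IsWeaklyRegular.cons hxreg hw'

/-- **In a Cohen–Macaulay local ring every system of parameters is a (weakly) regular sequence**
(Matsumura, Thm. 17.4 (iii)): if the Noetherian local ring `(S, 𝔪)` has an `S`-regular sequence
in `𝔪` of length `dim S`, then every system of parameters `s` (`dim S` elements, `rad (s) = 𝔪`)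
is a weakly regular sequence on `S` in the given order. [cite: Matsumura1987, Thm. 17.4 (iii)] -/
theorem stub_sopWeaklyRegular {S : Type*} [CommRing S] [IsNoetherianRing S] [IsLocalRing S]
    (hCM : ∃ rs : List S, RingTheory.Sequence.IsRegular S rs ∧ (∀ r ∈ rs, r ∈ maximalIdeal S) ∧
      (rs.length : WithBot ℕ∞) = ringKrullDim S)
    ⦃n : ℕ⦄ (s : Fin n → S) (hs : IsSystemOfParameters s) :
    RingTheory.Sequence.IsWeaklyRegular S (List.ofFn s) := by
  obtain ⟨rs, hrs, hmem, hdim⟩ := hCM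
  exact isWeaklyRegular_ofFn_of_isSystemOfParameters_aux n S rs hrs hmem hdim s hs

end Literature.RingTheory.TightClosure.ParameterIdealClosure.SopWeaklyRegular

end Part2

/-!
## Part 3 — port of `Summits/ResolutionOfSingularities/ResolutionOfSingularities/Theorems/FrobeniusLadderFInjectiveMacaulayficationCmLocalizes.lean` (3 declarations kept)

# Cohen–Macaulayness localizes, s.o.p. form

`(R, 𝔪)` Noetherian local with every system of parameters a weakly regular sequence; `P` a prime of height `h`; a system of
parameters `Fin.append x t` of `R` whose head `x : Fin h → R` lies in `P`.  Then every system of parameters of `R_P` is weakly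
regular (`stub_cmLocalizes`, historical name kept): the prefix `x` is weakly regular on `R` (`isWeaklyRegular_ofFn_left`), its
image in `R_P` is an `R_P`-regular sequence in `P R_P` of length `h = ht P = dim R_P` (`exists_isRegular_localization`), so `R_P`
is Cohen–Macaulay and the previous Part applies.  Reference: [Matsumura1987, Thm. 17.3 (iii), Thm. 17.4 (iii)].
-/

section Part3

open _root_.IsLocalRing RingTheory.Sequence Literature.RingTheory.TightClosure

namespace Literature.RingTheory.TightClosure.CMFILocalization.CmLocalizes

/-- **The head of a weakly regular concatenation is weakly regular**: if `List.ofFn (Fin.append x t)`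
is weakly regular on `R`, so is `List.ofFn x`. [cite: Matsumura1987, Thm 17.3 (iii) (a localization of a Cohen–Macaulay local ring is Cohen–Macaulay)] -/
theorem isWeaklyRegular_ofFn_left {R : Type*} [CommRing R] {h e : ℕ} (x : Fin h → R)
    (t : Fin e → R) (hreg : IsWeaklyRegular R (List.ofFn (Fin.append x t))) :
    IsWeaklyRegular R (List.ofFn x) := by
  rw [List.ofFn_fin_append] at hreg
  exact ((isWeaklyRegular_append_iff R (List.ofFn x) (List.ofFn t)).mp hreg).1

/-- **A weakly regular sequence inside `P` becomes a maximal regular sequence of `R_P` when its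
length is `ht P`**: if `x : Fin h → R` is weakly regular on `R`, `x ⊆ P` and `ht P = h`, then the
image of `x` in `R_P` is an `R_P`-regular sequence in the maximal ideal of `R_P` of length
`dim R_P`, i.e. `R_P` is Cohen–Macaulay in the tree's phrasing. [cite: Matsumura1987, Thm 17.3 (iii)] -/
theorem exists_isRegular_localization {R : Type*} [CommRing R] (P : Ideal R) [P.IsPrime] {h : ℕ}
    (x : Fin h → R) (hreg : IsWeaklyRegular R (List.ofFn x)) (hxP : ∀ i, x i ∈ P)
    (hht : P.height = h) :
    ∃ rs : List (Localization.AtPrime P),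
      IsRegular (Localization.AtPrime P) rs ∧
        (∀ r ∈ rs, r ∈ maximalIdeal (Localization.AtPrime P)) ∧
        (rs.length : WithBot ℕ∞) = ringKrullDim (Localization.AtPrime P) := by
  have hmem : ∀ r ∈ List.ofFn x, r ∈ P := List.forall_mem_ofFn_iff.mpr hxP
  refine ⟨(List.ofFn x).map (algebraMap R (Localization.AtPrime P)),
    hreg.isRegular_of_isLocalization_of_mem (Localization.AtPrime P) P hmem, ?_, ?_⟩
  · intro r hr
    obtain ⟨a, ha, rfl⟩ := List.mem_map.mp hr
    exact (IsLocalization.AtPrime.to_map_mem_maximal_iff (Localization.AtPrime P) P a).mpr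
      (hmem a ha)
  · rw [List.length_map, List.length_ofFn,
      IsLocalization.AtPrime.ringKrullDim_eq_height P (Localization.AtPrime P), hht]
    rfl

/-- **Cohen–Macaulayness localizes, s.o.p. form.** If every system of parameters of the Noetherian
local ring `R` is a weakly regular sequence, and the prime `P` of height `h` contains the head
`x : Fin h → R` of a system of parameters `(x, t)` of `R` (and is minimal over `(x)` — not needed),
then every system of parameters of `R_P` is a weakly regular sequence: `x` is weakly regular on `R`
(prefix of `(x, t)`), so its image is an `R_P`-regular sequence inside `P R_P` of length
`h = dim R_P`, and `ParameterIdealClosure.SopWeaklyRegular.stub_sopWeaklyRegular`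
(Matsumura, Thm 17.4 (iii)) applies to `R_P`. [cite: Matsumura1987, Thm 17.3 (iii)] -/
theorem stub_cmLocalizes : ∀ (R : Type uR) [CommRing R] [IsNoetherianRing R] [IsLocalRing R],
    (∀ ⦃n : ℕ⦄ (u : Fin n → R), Literature.RingTheory.TightClosure.IsSystemOfParameters u →
      RingTheory.Sequence.IsWeaklyRegular R (List.ofFn u)) →
    ∀ (P : Ideal R) [P.IsPrime] (h e : ℕ) (x : Fin h → R) (t : Fin e → R),
      Literature.RingTheory.TightClosure.IsSystemOfParameters (Fin.append x t) → (∀ i, x i ∈ P) →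
      P ∈ (Ideal.span (Set.range x)).minimalPrimes → P.height = h →
      ∀ ⦃n : ℕ⦄ (u : Fin n → Localization.AtPrime P),
        Literature.RingTheory.TightClosure.IsSystemOfParameters u →
        RingTheory.Sequence.IsWeaklyRegular (Localization.AtPrime P) (List.ofFn u) := by
  intro R _ _ _ hCM P _ h e x t hxt hxP _ hht n u hu
  exact Literature.RingTheory.TightClosure.ParameterIdealClosure.SopWeaklyRegular.stub_sopWeaklyRegular
    (exists_isRegular_localization P x (isWeaklyRegular_ofFn_left x t (hCM _ hxt)) hxP hht) u hu

end Literature.RingTheory.TightClosure.CMFILocalization.CmLocalizes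

end Part3

/-!
## Part 4 — port of `Summits/ResolutionOfSingularities/ResolutionOfSingularities/Theorems/FrobeniusLadderFRationalModificationExchange.lean` (3 declarations kept)

# Colon capturing along a system of parameters (three helper lemmas)

`ofList_ofFn` (list bookkeeping), `mul_mem_of_forall_mem_span`, and the colon-capturing lemma `mem_span_of_mul_mem`: in a local
ring in which every system of parameters is a weakly regular sequence (in the given order), if `(v, b)` is a system of
parameters then `b x ∈ (v) ⇒ x ∈ (v)`.  (The source module's exchange lemma for tightly closed parameter ideals is not
re-homed.)  Reference: R. Fedder, K.-i. Watanabe, *A characterization of F-regularity in terms of F-purity*, MSRI Publ. 15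
(1989), proof of Prop. 2.2 [FedderWatanabe1989].
-/

section Part4

namespace Literature.RingTheory.TightClosure.ParameterIdealClosure.Exchange

open _root_.IsLocalRing RingTheory.Sequence Literature.RingTheory.TightClosure

variable {R : Type*} [CommRing R]

/-- `Ideal.ofList (List.ofFn u) = Ideal.span (Set.range u)`: the ideal of the list of values of a
tuple is the ideal generated by its range. [cite: FedderWatanabe1989, proof of Prop. 2.2 (colon capturing along a system of parameters; helper lemmas)] -/
theorem ofList_ofFn {d : ℕ} (u : Fin d → R) :
    Ideal.ofList (List.ofFn u) = Ideal.span (Set.range u) := by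
  change Ideal.span {r | r ∈ List.ofFn u} = Ideal.span (Set.range u)
  congr 1
  ext r
  rw [Set.mem_setOf_eq, List.mem_ofFn']

/-- If `β x ∈ A` for every generator `x ∈ S`, then `β y ∈ A` for every `y ∈ span S`
(i.e. `β · span S ⊆ A`). [cite: FedderWatanabe1989, proof of Prop. 2.2 (colon capturing along a system of parameters; helper lemmas)] -/
theorem mul_mem_of_forall_mem_span {S : Set R} {A : Ideal R} {β : R}
    (h : ∀ x ∈ S, β * x ∈ A) {y : R} (hy : y ∈ Ideal.span S) : β * y ∈ A := by
  induction hy using Submodule.span_induction with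
  | mem x hx => exact h x hx
  | zero => rw [mul_zero]; exact zero_mem A
  | add x y _ _ hx hy => rw [mul_add]; exact add_mem hx hy
  | smul r x _ hx => rw [smul_eq_mul, mul_left_comm]; exact Ideal.mul_mem_left A r hx

/-- **Colon capturing for the last parameter.** In a local ring of dimension `d + 1` in which every
system of parameters is a weakly regular sequence (in the given order), if `rad (a, u) = 𝔪` with
`u : Fin d → R` then `a` is a non-zero-divisor modulo `(u)`: `a x ∈ (u) ⇒ x ∈ (u)` (apply the
hypothesis to the system of parameters `(u, a) = Fin.snoc u a`, listed as `List.ofFn u ++ [a]` by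
`Literature.LinearAlgebra.Matrix.IntSolve.ofFn_snoc`, whose last member `a` is regular on `R/(u)`).
[cite: FedderWatanabe1989, proof of Prop. 2.2 (colon capturing along a system of parameters; helper lemmas)] -/
theorem mem_span_of_mul_mem [IsLocalRing R]
    (hCM : ∀ ⦃n : ℕ⦄ (s : Fin n → R), IsSystemOfParameters s → IsWeaklyRegular R (List.ofFn s))
    {d : ℕ} (hd : ringKrullDim R = ((d + 1 : ℕ) : WithBot ℕ∞)) {a : R} {u : Fin d → R}
    (ha : (Ideal.span (insert a (Set.range u))).radical = maximalIdeal R) {x : R}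
    (hx : a * x ∈ Ideal.span (Set.range u)) : x ∈ Ideal.span (Set.range u) := by
  have hsop : IsSystemOfParameters (Fin.snoc u a : Fin (d + 1) → R) :=
    ⟨hd, by rw [Fin.range_snoc]; exact ha⟩
  have hreg := hCM _ hsop
  rw [Literature.LinearAlgebra.Matrix.IntSolve.ofFn_snoc, isWeaklyRegular_append_iff,
    isWeaklyRegular_singleton_iff, ofList_ofFn] at hreg
  have key : ∀ y : R, y ∈ (Ideal.span (Set.range u) • ⊤ : Submodule R R) ↔
      y ∈ Ideal.span (Set.range u) := fun y => by
    rw [Ideal.smul_eq_mul, Ideal.mul_top]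
  exact (key x).mp (mem_of_isSMulRegular_quotient_of_smul_mem hreg.2 ((key _).mpr hx))

end Literature.RingTheory.TightClosure.ParameterIdealClosure.Exchange

end Part4

/-!
## Part 5 — port of `Summits/ResolutionOfSingularities/ResolutionOfSingularities/Theorems/FrobeniusLadderFInjectiveMacaulayficationFedderCriterion.lean` (1 declarations kept)

# Frobenius powers commute with extension of ideals (one bookkeeping lemma)

`frobeniusPower_map`: `(I.map f)^[q] = (I^[q]).map f` for a ring map `f : A → B` of rings of exponential characteristic `p`
(`Literature.RingTheory.TightClosure.frobeniusPower`).  (The source module's Fedder criterion for hypersurfaces is not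
re-homed.)  Reference: R. Fedder, *F-purity and rational singularity*, Trans. AMS 278 (1983), Prop. 1.7 [Fedder1983].
-/

section Part5

namespace Literature.RingTheory.TightClosure.CMFILocalization.Fedder

open _root_.IsLocalRing RingTheory.Sequence Literature.RingTheory.TightClosure
  Literature.AlgebraicGeometry.Resolution
  Literature.RingTheory.TightClosure.ParameterIdealClosure

variable {R : Type*} [CommRing R]

/-! ## §1 Two bookkeeping lemmas -/

/-- Frobenius powers commute with extension of ideals along a ring map between rings of exponential
characteristic `p`: `(I S)^[q] = I^[q] S` for `q = p^e`. [cite: Fedder1983, Prop. 1.7 and Thm. 1.12 (Frobenius powers commute with extension of ideals; bookkeeping)] -/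
theorem frobeniusPower_map {A B : Type*} [CommRing A] [CommRing B] (p : ℕ) [ExpChar A p] [ExpChar B p]
    (φ : A →+* B) (e : ℕ) (I : Ideal A) :
    frobeniusPower (p ^ e) (I.map φ) = (frobeniusPower (p ^ e) I).map φ := by
  rw [frobeniusPower_eq_map_iterateFrobenius, frobeniusPower_eq_map_iterateFrobenius, Ideal.map_map,
    Ideal.map_map]
  congr 1
  ext a
  simp only [RingHom.coe_comp, Function.comp_apply, iterateFrobenius_def, map_pow]

end Literature.RingTheory.TightClosure.CMFILocalization.Fedder

end Part5

/-!
## Part 6 — port of `Summits/ResolutionOfSingularities/ResolutionOfSingularities/Theorems/FrobeniusLadderFRationalModificationPowerLift.lean` (2 declarations kept)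

# Frobenius powers of parameter ideals (two helper lemmas)

`frobeniusPower_span_insert_range` (`(a, u)^[q] = (a^q, u^q)`) and `radical_frobeniusPower` (`rad I^[q] = rad I`).  (The
source module's power lift for tightly closed parameter ideals is not re-homed; its Frobenius-closure analogue is the next
Part.)  Reference: [FedderWatanabe1989, proof of Prop. 2.2].
-/

section Part6

namespace Literature.RingTheory.TightClosure.ParameterIdealClosure.PowerLift

open _root_.IsLocalRing RingTheory.Sequence Literature.RingTheory.TightClosure

section Helpers

variable {R : Type*} [CommRing R]

/-! ## Frobenius powers of parameter ideals -/

/-- The Frobenius power of `(b, v)` is `(b^q, v^q)` (`q = p^e`). [cite: FedderWatanabe1989, proof of Prop. 2.2 (Frobenius powers of parameter ideals; helper lemmas)] -/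
theorem frobeniusPower_span_insert_range (p : ℕ) [ExpChar R p] (e : ℕ) (b : R) {n : ℕ}
    (v : Fin n → R) :
    frobeniusPower (p ^ e) (Ideal.span (insert b (Set.range v))) =
      Ideal.span (insert (b ^ p ^ e) (Set.range fun i => v i ^ p ^ e)) := by
  rw [frobeniusPower_span, Set.image_insert_eq, ← Set.range_comp]
  rfl

/-- A Frobenius power `I^[q]`, `q ≠ 0`, has the same radical as `I`. [cite: FedderWatanabe1989, proof of Prop. 2.2 (Frobenius powers of parameter ideals; helper lemmas)] -/
theorem radical_frobeniusPower {q : ℕ} (hq : q ≠ 0) (I : Ideal R) :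
    (frobeniusPower q I).radical = I.radical :=
  le_antisymm (Ideal.radical_mono (frobeniusPower_le hq I))
    (Ideal.radical_le_radical_iff.mpr fun _ hx => Ideal.mem_radical_iff.mpr
      ⟨q, pow_mem_frobeniusPower hx⟩)

/-! ## The inductive step -/

end Helpers

/-! ## The theorem -/

end Literature.RingTheory.TightClosure.ParameterIdealClosure.PowerLift

end Part6

/-!
## Part 7 — port of `Summits/ResolutionOfSingularities/ResolutionOfSingularities/Theorems/FrobeniusLadderFInjectiveMacaulayficationFrobeniusClosedMove.lean` (4 declarations kept)

# Moving one parameter of a Frobenius closed parameter ideal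

Let `(R, 𝔪)` be a local ring of prime characteristic `p` and dimension `d + 1` in which every system of parameters is a
weakly regular sequence (in the given order), and let `(a, u)` (`u : Fin d → R`, `rad (a, u) = 𝔪`) be a parameter ideal that
is FROBENIUS CLOSED (`x^q ∈ (a, u)^[q] ⇒ x ∈ (a, u)`, `q = p^e`; `Literature.RingTheory.TightClosure.IsFrobeniusClosed`).  Then
* `isFrobeniusClosed_span_insert_pow` — `(aᵏ, u)` is Frobenius closed for every `k ≥ 1` (Fedder–Watanabe 1989, proof of
  Prop. 2.2, with witness `c = 1`: for `y = α a + β`, colon capturing along the system of parameters `u^q, a^q`);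
* `isFrobeniusClosed_exchange` — if `a ∈ (b, u)` then `(b, u)` is Frobenius closed (one-generator linkage);
* `isFrobeniusClosed_move` — consequently (Noetherian `R`) EVERY parameter ideal `(b, u)` sharing the `d` parameters `u`
  with `(a, u)` is Frobenius closed.
No domain hypothesis.  References: [FedderWatanabe1989, proof of Prop. 2.2]; [Fedder1983].
-/

section Part7

namespace Literature.RingTheory.TightClosure.CMFILocalization.Move

open _root_.IsLocalRing RingTheory.Sequence Literature.RingTheory.TightClosure
open Literature.RingTheory.TightClosure.ParameterIdealClosure

variable {R : Type*} [CommRing R]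

/-! ## Raising one parameter to a power -/

/-- **Inductive step**: if `(a, u)` and `(aᵏ, u)` are Frobenius closed then so is `(a^{k+1}, u)`.
For `y ∈ (a^{k+1}, u)^F ⊆ (a, u)^F = (a, u)` write `y = α a + β` (`β ∈ (u)`); then `α a ∈ (a^{k+1}, u)^F`,
so for some `q = p^e`, `a^q (α^q - λ (aᵏ)^q) ∈ (u^q)` and colon capturing along the system of parameters
`u^q, a^q` gives `α^q ∈ (aᵏ, u)^[q]`, i.e. `α ∈ (aᵏ, u)^F = (aᵏ, u)` and `y ∈ (a^{k+1}, u)`.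
[cite: FedderWatanabe1989, proof of Prop. 2.2] -/
theorem isFrobeniusClosed_span_insert_pow_succ (p : ℕ) [Fact p.Prime] [IsLocalRing R] [CharP R p]
    (hCM : ∀ ⦃n : ℕ⦄ (s : Fin n → R), IsSystemOfParameters s → IsWeaklyRegular R (List.ofFn s))
    {d : ℕ} (hd : ringKrullDim R = ((d + 1 : ℕ) : WithBot ℕ∞)) {a : R} {u : Fin d → R}
    (hau : (Ideal.span (insert a (Set.range u))).radical = maximalIdeal R)
    (hfc : IsFrobeniusClosed p (Ideal.span (insert a (Set.range u)))) {k : ℕ}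
    (ih : IsFrobeniusClosed p (Ideal.span (insert (a ^ k) (Set.range u)))) :
    IsFrobeniusClosed p (Ideal.span (insert (a ^ (k + 1)) (Set.range u))) := by
  have hp : p ≠ 0 := (Fact.out : p.Prime).ne_zero
  set U : Ideal R := Ideal.span (Set.range u)
  have hU1 : U ≤ Ideal.span (insert a (Set.range u)) := Ideal.span_mono (Set.subset_insert _ _)
  have hUk1 : U ≤ Ideal.span (insert (a ^ (k + 1)) (Set.range u)) :=
    Ideal.span_mono (Set.subset_insert _ _)
  have hk1_le : Ideal.span (insert (a ^ (k + 1)) (Set.range u)) ≤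
      Ideal.span (insert a (Set.range u)) := by
    refine Ideal.span_le.mpr (Set.insert_subset ?_ (Ideal.subset_span.trans hU1))
    exact Ideal.pow_mem_of_mem _ (Ideal.subset_span (Set.mem_insert _ _)) _ (Nat.succ_pos k)
  refine (isFrobeniusClosed_iff_le p).mpr fun y hy => ?_
  -- `y ∈ (a, u)`: `y = α a + β`, `β ∈ (u)`
  have hy1 : y ∈ Ideal.span (insert a (Set.range u)) :=
    ((isFrobeniusClosed_iff_le p).mp hfc) (frobeniusClosure_mono p hk1_le hy)
  obtain ⟨α, β, hβ, rfl⟩ := Ideal.mem_span_insert.mp hy1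
  -- `α a ∈ (a^{k+1}, u)^F`, with exponent `e`
  have hαa : α * a ∈ frobeniusClosure p (Ideal.span (insert (a ^ (k + 1)) (Set.range u))) :=
    (Submodule.add_mem_iff_left _ (le_frobeniusClosure p _ (hUk1 hβ))).mp hy
  obtain ⟨e, he⟩ := (mem_frobeniusClosure_iff p).mp hαa
  -- `α ∈ (a^k, u)^F`
  have hα : α ∈ frobeniusClosure p (Ideal.span (insert (a ^ k) (Set.range u))) := by
    refine (mem_frobeniusClosure_iff p).mpr ⟨e, ?_⟩
    rw [PowerLift.frobeniusPower_span_insert_range] at he ⊢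
    rw [mul_pow] at he
    obtain ⟨lam, v, hv, heq⟩ := Ideal.mem_span_insert.mp he
    -- `a^q (α^q - lam (a^k)^q) = v ∈ (u^q)`
    have hmul : a ^ p ^ e * (α ^ p ^ e - lam * (a ^ k) ^ p ^ e) ∈
        Ideal.span (Set.range fun i => u i ^ p ^ e) := by
      have h : a ^ p ^ e * (α ^ p ^ e - lam * (a ^ k) ^ p ^ e) = v := by
        rw [eq_sub_of_add_eq' heq.symm]
        ring
      rw [h]
      exact hv
    -- the parameter ideal `(a^q, u^q) = (a, u)^[q]` has radical `𝔪`
    have hrad : (Ideal.span (insert (a ^ p ^ e) (Set.range fun i => u i ^ p ^ e))).radical =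
        maximalIdeal R := by
      rw [← PowerLift.frobeniusPower_span_insert_range p e a u,
        PowerLift.radical_frobeniusPower (pow_ne_zero e hp), hau]
    have hcap := Exchange.mem_span_of_mul_mem hCM hd hrad hmul
    exact Ideal.mem_span_insert.mpr ⟨lam, _, hcap, by ring⟩
  -- `α ∈ (a^k, u)`, so `α a + β ∈ (a^{k+1}, u)`
  obtain ⟨μ, ν, hν, hαeq⟩ := Ideal.mem_span_insert.mp (((isFrobeniusClosed_iff_le p).mp ih) hα)
  refine Ideal.mem_span_insert.mpr ⟨μ, ν * a + β, add_mem (Ideal.mul_mem_right _ _ hν) hβ, ?_⟩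
  rw [hαeq]
  ring

/-- **Raising one parameter to a power keeps the parameter ideal Frobenius closed**: with `R`
Cohen–Macaulay local of characteristic `p` and dimension `d + 1` as above, if `(a, u)` (`rad = 𝔪`) is
Frobenius closed then so is `(aᵏ, u)` for every `k ≥ 1`. [cite: FedderWatanabe1989, proof of Prop. 2.2] -/
theorem isFrobeniusClosed_span_insert_pow (p : ℕ) [Fact p.Prime] [IsLocalRing R] [CharP R p]
    (hCM : ∀ ⦃n : ℕ⦄ (s : Fin n → R), IsSystemOfParameters s → IsWeaklyRegular R (List.ofFn s))
    {d : ℕ} (hd : ringKrullDim R = ((d + 1 : ℕ) : WithBot ℕ∞)) {a : R} {u : Fin d → R}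
    (hau : (Ideal.span (insert a (Set.range u))).radical = maximalIdeal R)
    (hfc : IsFrobeniusClosed p (Ideal.span (insert a (Set.range u)))) {k : ℕ} (hk : 0 < k) :
    IsFrobeniusClosed p (Ideal.span (insert (a ^ k) (Set.range u))) := by
  induction k, hk using Nat.le_induction with
  | base => rw [pow_one]; exact hfc
  | succ k _ ih => exact isFrobeniusClosed_span_insert_pow_succ p hCM hd hau hfc ih

/-! ## Exchanging one parameter -/

/-- **Exchanging one parameter**: `(R, 𝔪)` local of characteristic `p` and dimension `d + 1`,
Cohen–Macaulay (every system of parameters weakly regular); if the parameter ideal `(a, u)`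
(`rad (a, u) = 𝔪`) is Frobenius closed and `a ∈ (b, u)`, then `(b, u)` is Frobenius closed. Write
`a = β b + z`, `z ∈ (u)`; then `β · (b, u) ⊆ (a, u)`, so for `y ∈ (b, u)^F` one has
`β y ∈ (a, u)^F = (a, u)`, `β y = λ a + z'`, `β (y - λ b) ∈ (u)`; and `β` is regular modulo `(u)` because
`a` is (`Exchange.mem_span_of_mul_mem`). [cite: FedderWatanabe1989, proof of Prop. 2.2] -/
theorem isFrobeniusClosed_exchange (p : ℕ) [Fact p.Prime] [IsLocalRing R] [CharP R p]
    (hCM : ∀ ⦃n : ℕ⦄ (s : Fin n → R), IsSystemOfParameters s → IsWeaklyRegular R (List.ofFn s))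
    {d : ℕ} (hd : ringKrullDim R = ((d + 1 : ℕ) : WithBot ℕ∞)) {a b : R} {u : Fin d → R}
    (ha : (Ideal.span (insert a (Set.range u))).radical = maximalIdeal R)
    (hab : a ∈ Ideal.span (insert b (Set.range u)))
    (hfc : IsFrobeniusClosed p (Ideal.span (insert a (Set.range u)))) :
    IsFrobeniusClosed p (Ideal.span (insert b (Set.range u))) := by
  have hUA : Ideal.span (Set.range u) ≤ Ideal.span (insert a (Set.range u)) :=
    Ideal.span_mono (Set.subset_insert _ _)
  have hUB : Ideal.span (Set.range u) ≤ Ideal.span (insert b (Set.range u)) :=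
    Ideal.span_mono (Set.subset_insert _ _)
  have haA : a ∈ Ideal.span (insert a (Set.range u)) := Ideal.subset_span (Set.mem_insert _ _)
  have hbB : b ∈ Ideal.span (insert b (Set.range u)) := Ideal.subset_span (Set.mem_insert _ _)
  -- `a = β b + z` with `z ∈ (u)`
  obtain ⟨β, z, hz, habz⟩ := Ideal.mem_span_insert.mp hab
  -- (1) `β · (b, u) ⊆ (a, u)`
  have hβB : ∀ w ∈ Ideal.span (insert b (Set.range u)),
      β * w ∈ Ideal.span (insert a (Set.range u)) := by
    intro w hw
    refine Exchange.mul_mem_of_forall_mem_span ?_ hw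
    rintro x (rfl | ⟨i, rfl⟩)
    · have hβx : β * x = a - z := by rw [habz]; ring
      rw [hβx]
      exact sub_mem haA (hUA hz)
    · exact Ideal.mul_mem_left _ _ (hUA (Ideal.subset_span ⟨i, rfl⟩))
  -- (2) `β` is a non-zero-divisor modulo `(u)`, because `a` is
  have hβU : ∀ x : R, β * x ∈ Ideal.span (Set.range u) → x ∈ Ideal.span (Set.range u) := by
    intro x hx
    refine Exchange.mem_span_of_mul_mem hCM hd ha ?_
    have hax : a * x = b * (β * x) + z * x := by rw [habz]; ring
    rw [hax]
    exact add_mem (Ideal.mul_mem_left _ _ hx) (Ideal.mul_mem_right _ _ hz)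
  -- (3) `β · (b, u)^F ⊆ (a, u)^F = (a, u)`, and conclude
  rw [isFrobeniusClosed_iff_le]
  intro y hy
  obtain ⟨e, he⟩ := (mem_frobeniusClosure_iff p).mp hy
  have hβy : β * y ∈ frobeniusClosure p (Ideal.span (insert a (Set.range u))) := by
    refine (mem_frobeniusClosure_iff p).mpr ⟨e, ?_⟩
    rw [mul_pow]
    rw [frobeniusPower_def] at he
    refine Exchange.mul_mem_of_forall_mem_span ?_ he
    rintro _ ⟨w, hw, rfl⟩
    show β ^ p ^ e * w ^ p ^ e ∈ _
    rw [← mul_pow]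
    exact pow_mem_frobeniusPower (hβB w hw)
  obtain ⟨lam, z', hz', hlam⟩ :=
    Ideal.mem_span_insert.mp (((isFrobeniusClosed_iff_le p).mp hfc) hβy)
  -- `β (y - λ b) = λ z + z' ∈ (u)`
  have hdiff : β * (y - lam * b) ∈ Ideal.span (Set.range u) := by
    have hβ' : β * (y - lam * b) = lam * z + z' := by
      rw [habz] at hlam
      linear_combination hlam
    rw [hβ']
    exact add_mem (Ideal.mul_mem_left _ _ hz) hz'
  have hy' : y = lam * b + (y - lam * b) := by ring
  rw [hy']
  exact add_mem (Ideal.mul_mem_left _ _ hbB) (hUB (hβU _ hdiff))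

/-! ## Moving one parameter arbitrarily -/

/-- **Moving one parameter**: `(R, 𝔪)` Noetherian local of characteristic `p` and dimension `d + 1`,
Cohen–Macaulay (every system of parameters weakly regular). If the parameter ideal `(a, u)` (`rad = 𝔪`)
is Frobenius closed, then EVERY parameter ideal `(b, u)` (`rad = 𝔪`) with the same `u` is Frobenius
closed: `aᴺ ∈ 𝔪ᴺ ⊆ (b, u)` for some `N ≥ 1`, `(aᴺ, u)` is Frobenius closed
(`isFrobeniusClosed_span_insert_pow`), exchange `aᴺ` for `b` (`isFrobeniusClosed_exchange`).
[cite: FedderWatanabe1989, proof of Prop. 2.2] -/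
theorem isFrobeniusClosed_move (p : ℕ) [Fact p.Prime] [IsNoetherianRing R] [IsLocalRing R]
    [CharP R p]
    (hCM : ∀ ⦃n : ℕ⦄ (s : Fin n → R), IsSystemOfParameters s → IsWeaklyRegular R (List.ofFn s))
    {d : ℕ} (hd : ringKrullDim R = ((d + 1 : ℕ) : WithBot ℕ∞)) {a b : R} {u : Fin d → R}
    (ha : (Ideal.span (insert a (Set.range u))).radical = maximalIdeal R)
    (hb : (Ideal.span (insert b (Set.range u))).radical = maximalIdeal R)
    (hfc : IsFrobeniusClosed p (Ideal.span (insert a (Set.range u)))) :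
    IsFrobeniusClosed p (Ideal.span (insert b (Set.range u))) := by
  have ham : a ∈ maximalIdeal R := by
    rw [← ha]; exact Ideal.le_radical (Ideal.subset_span (Set.mem_insert _ _))
  -- cofinality: `a^(N+1) ∈ 𝔪^(N+1) ⊆ (b, u)`
  obtain ⟨N, hN⟩ := Ideal.exists_pow_le_of_le_radical_of_fg hb.ge
    (IsNoetherian.noetherian (maximalIdeal R))
  have haN : a ^ (N + 1) ∈ Ideal.span (insert b (Set.range u)) :=
    ((Ideal.pow_le_pow_right (Nat.le_succ N)).trans hN) (Ideal.pow_mem_pow ham _)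
  have hfcN : IsFrobeniusClosed p (Ideal.span (insert (a ^ (N + 1)) (Set.range u))) :=
    isFrobeniusClosed_span_insert_pow p hCM hd ha hfc (Nat.succ_pos N)
  have haNrad : (Ideal.span (insert (a ^ (N + 1)) (Set.range u))).radical = maximalIdeal R := by
    have h1 : (Ideal.span (insert (a ^ (N + 1)) (Set.range u))).radical =
        (Ideal.span (insert a (Set.range u))).radical := by
      apply le_antisymm
      · refine Ideal.radical_mono (Ideal.span_le.mpr (Set.insert_subset ?_ ?_))
        · exact Ideal.pow_mem_of_mem _ (Ideal.subset_span (Set.mem_insert _ _)) _ (Nat.succ_pos N)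
        · exact (Set.subset_insert _ _).trans Ideal.subset_span
      · refine Ideal.radical_le_radical_iff.mpr (Ideal.span_le.mpr (Set.insert_subset ?_ ?_))
        · exact ⟨N + 1, Ideal.subset_span (Set.mem_insert _ _)⟩
        · exact (Set.subset_insert _ _).trans (Ideal.subset_span.trans Ideal.le_radical)
    rw [h1, ha]
  exact isFrobeniusClosed_exchange p hCM hd haNrad haN hfcN

/-! ## Registration-friendly restatement (all binders explicit) -/

end Literature.RingTheory.TightClosure.CMFILocalization.Move

end Part7

/-!
## Part 8 — port of `Summits/ResolutionOfSingularities/ResolutionOfSingularities/Theorems/FrobeniusLadderFInjectiveMacaulayficationOneParameterIdeal.lean` (7 declarations kept)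

# One Frobenius closed parameter ideal makes all of them Frobenius closed (Cohen–Macaulay local rings)

Let `(R, 𝔪)` be a Noetherian local ring of prime characteristic `p` in which every system of parameters is a weakly regular
sequence.  **If ONE ideal generated by a system of parameters is Frobenius closed, then EVERY ideal generated by a system of
parameters is Frobenius closed** (`isFrobeniusClosed_of_isFrobeniusClosed_sop`; Fedder 1983 / Quy–Shimomoto 2017 §3, here
WITHOUT local cohomology): two systems of parameters are joined by a chain whose consecutive members differ in one element
(prime avoidance against the minimal primes of the two `d`-element sub-ideals — `exists_mem_maximalIdeal_radical_eq_and`,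
`radical_span_insert_eq_of_forall_notMem`), and Frobenius-closedness moves along one-element exchanges (previous Part;
`isFrobeniusClosed_move_finset`, `isFrobeniusClosed_transfer_aux`).  (The source module's consequences for blow-up centres are
not re-homed.)  References: R. Fedder, Trans. AMS 278 (1983), Thm. 1.12 [Fedder1983]; P. H. Quy, K. Shimomoto, Adv. Math. 313
(2017) §3 [QuyShimomoto2017]; [FedderWatanabe1989, proof of Prop. 2.2].
-/

section Part8

namespace Literature.RingTheory.TightClosure.CMFILocalization.OneSop

open _root_.IsLocalRing RingTheory.Sequence Literature.RingTheory.TightClosure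

variable {R : Type*} [CommRing R]

/-! ## §1 Prime avoidance: a common completion of two `d`-element sub-ideals to parameter ideals -/

section Avoid

variable [IsNoetherianRing R] [IsLocalRing R]

/-- In a Noetherian local ring of dimension `d + 1`, no minimal prime of an ideal generated by at most
`d` elements is the maximal ideal (Krull's height theorem: such a prime has height `≤ d < d + 1 = ht 𝔪`).
[cite: Fedder1983, Thm. 1.12 with QuyShimomoto2017 §3 (one Frobenius closed parameter ideal of a Cohen–Macaulay local ring makes all of them Frobenius closed)] -/
theorem ne_maximalIdeal_of_mem_minimalPrimes {d : ℕ}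
    (hd : ringKrullDim R = ((d + 1 : ℕ) : WithBot ℕ∞)) (D : Finset R) (hD : D.card ≤ d)
    {P : Ideal R} (hP : P ∈ (Ideal.span (↑D : Set R)).minimalPrimes) : P ≠ maximalIdeal R := by
  intro hPm
  have h1 : P.height ≤ D.card := Ideal.height_le_card_of_mem_minimalPrimes_span_finset hP
  have h2 : (maximalIdeal R).height = ((d + 1 : ℕ) : ℕ∞) := by
    have h := IsLocalRing.maximalIdeal_height_eq_ringKrullDim (R := R)
    rw [hd] at h
    exact_mod_cast h
  rw [hPm, h2] at h1
  have : d + 1 ≤ D.card := by exact_mod_cast h1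
  omega

/-- If `rad (x, D) = 𝔪` and `w ∈ 𝔪` lies in no minimal prime of `(D)`, then `rad (w, D) = 𝔪`: a prime
`Q ⊇ (w, D)` contains a minimal prime `P` of `(D)` strictly (`w ∈ Q ∖ P`), and in `R/(D)` — a local ring
whose maximal ideal is minimal over the principal ideal `(x̄)`, hence of dimension `≤ 1` by Krull's
principal ideal theorem — every prime is minimal or maximal, so `Q = 𝔪`. [cite: Fedder1983, Thm. 1.12 with QuyShimomoto2017 §3 (one Frobenius closed parameter ideal of a Cohen–Macaulay local ring makes all of them Frobenius closed)] -/
theorem radical_span_insert_eq_of_forall_notMem (D : Finset R) {x : R}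
    (hx : (Ideal.span (insert x (↑D : Set R))).radical = maximalIdeal R) {w : R}
    (hw : w ∈ maximalIdeal R) (havoid : ∀ P ∈ (Ideal.span (↑D : Set R)).minimalPrimes, w ∉ P) :
    (Ideal.span (insert w (↑D : Set R))).radical = maximalIdeal R := by
  set K : Ideal R := Ideal.span (↑D : Set R) with hK
  have hKx : Ideal.span (insert x (↑D : Set R)) = K ⊔ Ideal.span {x} := by
    rw [Ideal.span_insert, sup_comm]
  have hKw : Ideal.span (insert w (↑D : Set R)) = K ⊔ Ideal.span {w} := by
    rw [Ideal.span_insert, sup_comm]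
  have hKm : K ≤ maximalIdeal R := by
    rw [← hx, hKx]
    exact le_sup_left.trans Ideal.le_radical
  -- `𝔪` is the only prime over `K + (x)`, in particular a minimal one
  have hmin : maximalIdeal R ∈ (K ⊔ Ideal.span {x}).minimalPrimes := by
    rw [← hKx, ← Ideal.radical_minimalPrimes, hx, Ideal.minimalPrimes_eq_subsingleton_self]
    exact Set.mem_singleton _
  -- `dim R/K ≤ 1`
  have hKtop : K ≠ ⊤ := fun h => (maximalIdeal.isMaximal R).ne_top (top_le_iff.mp (h ▸ hKm))
  haveI : Nontrivial (R ⧸ K) := Ideal.Quotient.nontrivial_iff.mpr hKtop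
  haveI : IsLocalRing (R ⧸ K) :=
    IsLocalRing.of_surjective' (Ideal.Quotient.mk K) Ideal.Quotient.mk_surjective
  have hdim : ringKrullDim (R ⧸ K) ≤ 1 := by
    rw [← IsLocalRing.maximalIdeal_height_eq_ringKrullDim,
      ← IsLocalRing.map_maximalIdeal_of_surjective (Ideal.Quotient.mk K) Ideal.Quotient.mk_surjective]
    exact_mod_cast Ideal.map_height_le_one_of_mem_minimalPrimes hmin
  haveI : Ring.KrullDimLE 1 (R ⧸ K) := ⟨by exact_mod_cast hdim⟩
  -- the radical computation
  apply le_antisymm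
  · refine (maximalIdeal.isMaximal R).isPrime.radical_le_iff.mpr ?_
    rw [hKw]
    exact sup_le hKm ((Ideal.span_singleton_le_iff_mem _).mpr hw)
  · rw [Ideal.radical_eq_sInf]
    refine le_sInf ?_
    rintro Q ⟨hJQ, hQ⟩
    have hKQ : K ≤ Q := le_sup_left.trans (hKw ▸ hJQ)
    have hwQ : w ∈ Q := hJQ (Ideal.subset_span (Set.mem_insert _ _))
    have hker : RingHom.ker (Ideal.Quotient.mk K) ≤ Q := by rw [Ideal.mk_ker]; exact hKQ
    have hQ' : (Q.map (Ideal.Quotient.mk K)).IsPrime :=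
      Ideal.map_isPrime_of_surjective Ideal.Quotient.mk_surjective hker
    have hcomap : (Q.map (Ideal.Quotient.mk K)).comap (Ideal.Quotient.mk K) = Q := by
      rw [Ideal.comap_map_of_surjective _ Ideal.Quotient.mk_surjective,
        ← RingHom.ker_eq_comap_bot, sup_eq_left.mpr hker]
    rcases (Ring.krullDimLE_one_iff.mp inferInstance) _ hQ' with hQmin | hQmax
    · -- `Q` would be a minimal prime of `K` containing `w`
      exfalso
      refine havoid Q ?_ hwQ
      rw [Ideal.minimalPrimes_eq_comap]
      exact ⟨_, hQmin, hcomap⟩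
    · have hQmax' : Q.IsMaximal := by
        rw [← hcomap]
        exact Ideal.comap_isMaximal_of_surjective _ Ideal.Quotient.mk_surjective
      rw [IsLocalRing.eq_maximalIdeal hQmax']

/-- **A common parameter.** In a Noetherian local ring of dimension `d + 1`, if `(x₁, D₁)` and
`(x₂, D₂)` are parameter ideals (`rad = 𝔪`) with `|D₁|, |D₂| ≤ d`, then some `w ∈ 𝔪` makes BOTH
`(w, D₁)` and `(w, D₂)` parameter ideals: choose `w` outside the finitely many minimal primes of `(D₁)`
and of `(D₂)`, none of which is `𝔪` (prime avoidance). [cite: Fedder1983, Thm. 1.12 with QuyShimomoto2017 §3 (one Frobenius closed parameter ideal of a Cohen–Macaulay local ring makes all of them Frobenius closed)] -/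
theorem exists_mem_maximalIdeal_radical_eq_and {d : ℕ}
    (hd : ringKrullDim R = ((d + 1 : ℕ) : WithBot ℕ∞)) (D₁ D₂ : Finset R)
    (hD₁ : D₁.card ≤ d) (hD₂ : D₂.card ≤ d) {x₁ x₂ : R}
    (h₁ : (Ideal.span (insert x₁ (↑D₁ : Set R))).radical = maximalIdeal R)
    (h₂ : (Ideal.span (insert x₂ (↑D₂ : Set R))).radical = maximalIdeal R) :
    ∃ w ∈ maximalIdeal R, (Ideal.span (insert w (↑D₁ : Set R))).radical = maximalIdeal R ∧
      (Ideal.span (insert w (↑D₂ : Set R))).radical = maximalIdeal R := by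
  classical
  set S : Set (Ideal R) := (Ideal.span (↑D₁ : Set R)).minimalPrimes ∪
    (Ideal.span (↑D₂ : Set R)).minimalPrimes with hS
  have hSfin : S.Finite :=
    ((Ideal.span (↑D₁ : Set R)).finite_minimalPrimes_of_isNoetherianRing).union
      ((Ideal.span (↑D₂ : Set R)).finite_minimalPrimes_of_isNoetherianRing)
  have hSprime : ∀ P ∈ S, P.IsPrime := by
    rintro P (hP | hP) <;> exact hP.1.1
  have hSne : ∀ P ∈ S, P ≠ maximalIdeal R := by
    rintro P (hP | hP)
    · exact ne_maximalIdeal_of_mem_minimalPrimes hd D₁ hD₁ hP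
    · exact ne_maximalIdeal_of_mem_minimalPrimes hd D₂ hD₂ hP
  -- prime avoidance: `𝔪 ⊄ ⋃ S`
  have havoid : ¬ ((maximalIdeal R : Set R) ⊆ ⋃ P ∈ S, (P : Set R)) := by
    rw [Ideal.subset_union_prime_finite hSfin (maximalIdeal R) (maximalIdeal R)
      (fun P hP _ _ => hSprime P hP)]
    rintro ⟨P, hPS, hle⟩
    exact hSne P hPS ((maximalIdeal.isMaximal R).eq_of_le (hSprime P hPS).ne_top hle).symm
  obtain ⟨w, hwm, hw⟩ := Set.not_subset.mp havoid
  have hw' : ∀ P ∈ S, w ∉ P := fun P hP hwP => hw (Set.mem_biUnion hP hwP)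
  exact ⟨w, hwm,
    radical_span_insert_eq_of_forall_notMem D₁ h₁ hwm fun P hP => hw' P (Or.inl hP),
    radical_span_insert_eq_of_forall_notMem D₂ h₂ hwm fun P hP => hw' P (Or.inr hP)⟩

end Avoid

/-! ## §2 From finite sets to tuples, and the one-element move on finite sets -/

/-- A finite set of at most `d` elements is, up to the ideal it generates, the range of a `d`-tuple
(enumerate and repeat an element; the empty set is matched by the zero tuple). [cite: Fedder1983, Thm. 1.12 with QuyShimomoto2017 §3 (one Frobenius closed parameter ideal of a Cohen–Macaulay local ring makes all of them Frobenius closed)] -/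
theorem exists_span_range_eq (D : Finset R) {d : ℕ} (hD : D.card ≤ d) :
    ∃ u : Fin d → R, Ideal.span (Set.range u) = Ideal.span (↑D : Set R) := by
  classical
  by_cases hD0 : D = ∅
  · refine ⟨fun _ => 0, ?_⟩
    subst hD0
    rw [Finset.coe_empty, Ideal.span_empty, Ideal.span_eq_bot]
    rintro _ ⟨i, rfl⟩
    rfl
  obtain ⟨x₀, hx₀⟩ := Finset.nonempty_iff_ne_empty.mpr hD0
  set e := D.equivFin with he
  refine ⟨fun i => if h : (i : ℕ) < D.card then (e.symm ⟨i, h⟩ : R) else x₀, ?_⟩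
  congr 1
  apply le_antisymm
  · rintro _ ⟨i, rfl⟩
    dsimp only
    split_ifs with h
    · exact (e.symm ⟨i, h⟩).2
    · exact hx₀
  · intro x hx
    set j := e ⟨x, hx⟩ with hj
    refine ⟨⟨j, lt_of_lt_of_le j.2 hD⟩, ?_⟩
    dsimp only
    rw [dif_pos j.2, Fin.eta, hj, Equiv.symm_apply_apply]

/-- **The one-element move on finite generating sets**: in a Noetherian local ring of characteristic
`p` and dimension `d + 1` in which every system of parameters is weakly regular, if `(a, D)` and `(b, D)` are
parameter ideals with `|D| ≤ d` and `(a, D)` is Frobenius closed, then so is `(b, D)`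
(`Move.isFrobeniusClosed_move` on a `d`-tuple enumerating `D`). [cite: FedderWatanabe1989, proof of Prop. 2.2] -/
theorem isFrobeniusClosed_move_finset (p : ℕ) [Fact p.Prime] [IsNoetherianRing R] [IsLocalRing R]
    [CharP R p]
    (hCM : ∀ ⦃n : ℕ⦄ (s : Fin n → R), IsSystemOfParameters s → IsWeaklyRegular R (List.ofFn s))
    {d : ℕ} (hd : ringKrullDim R = ((d + 1 : ℕ) : WithBot ℕ∞)) (D : Finset R) (hD : D.card ≤ d)
    {a b : R} (ha : (Ideal.span (insert a (↑D : Set R))).radical = maximalIdeal R)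
    (hb : (Ideal.span (insert b (↑D : Set R))).radical = maximalIdeal R)
    (hfc : IsFrobeniusClosed p (Ideal.span (insert a (↑D : Set R)))) :
    IsFrobeniusClosed p (Ideal.span (insert b (↑D : Set R))) := by
  obtain ⟨u, hu⟩ := exists_span_range_eq D hD
  have key : ∀ x : R, Ideal.span (insert x (Set.range u)) = Ideal.span (insert x (↑D : Set R)) := by
    intro x
    rw [Ideal.span_insert, Ideal.span_insert, hu]
  rw [← key] at ha hb hfc ⊢
  exact Move.isFrobeniusClosed_move p hCM hd ha hb hfc

/-! ## §3 The chain of exchanges -/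

/-- **Transfer along a chain of exchanges** (induction on the number `n` of generators allowed to
differ): for finite sets `A`, `B` (`|A|, |B| ≤ n`) and `C` (`|C| + n ≤ d + 1`) with `(A ∪ C)` and
`(B ∪ C)` parameter ideals, Frobenius-closedness passes from `(A ∪ C)` to `(B ∪ C)`. Step: pick
`a ∈ A`, `b ∈ B` (non-empty by Krull's height theorem), a common parameter `w` for `(A ∖ a) ∪ C` and
`(B ∖ b) ∪ C` (`exists_mem_maximalIdeal_radical_eq_and`), move `a ↦ w`, recurse with `C ∪ {w}`, move
`w ↦ b`. [cite: Fedder1983, Thm. 1.12 with QuyShimomoto2017 §3 (one Frobenius closed parameter ideal of a Cohen–Macaulay local ring makes all of them Frobenius closed)] -/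
theorem isFrobeniusClosed_transfer_aux (p : ℕ) [Fact p.Prime] [IsNoetherianRing R] [IsLocalRing R]
    [CharP R p]
    (hCM : ∀ ⦃n : ℕ⦄ (s : Fin n → R), IsSystemOfParameters s → IsWeaklyRegular R (List.ofFn s))
    {d : ℕ} (hd : ringKrullDim R = ((d + 1 : ℕ) : WithBot ℕ∞)) :
    ∀ (n : ℕ) (A B C : Finset R), A.card ≤ n → B.card ≤ n → C.card + n ≤ d + 1 →
      (Ideal.span ((↑A ∪ ↑C : Set R))).radical = maximalIdeal R →
      (Ideal.span ((↑B ∪ ↑C : Set R))).radical = maximalIdeal R →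
      IsFrobeniusClosed p (Ideal.span (↑A ∪ ↑C : Set R)) →
      IsFrobeniusClosed p (Ideal.span (↑B ∪ ↑C : Set R)) := by
  classical
  intro n
  induction n with
  | zero =>
    intro A B C hA hB _ _ _ hfc
    have hA0 : A = ∅ := Finset.card_eq_zero.mp (Nat.le_zero.mp hA)
    have hB0 : B = ∅ := Finset.card_eq_zero.mp (Nat.le_zero.mp hB)
    subst hA0; subst hB0
    exact hfc
  | succ n ih =>
    intro A B C hA hB hC hradA hradB hfc
    -- `A` and `B` are non-empty: `C` alone has `≤ d` elements and cannot be `𝔪`-primary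
    have hCd : C.card ≤ d := by omega
    have hne : ∀ E : Finset R, (Ideal.span ((↑E ∪ ↑C : Set R))).radical = maximalIdeal R →
        E.Nonempty := by
      intro E hE
      by_contra h0
      rw [Finset.not_nonempty_iff_eq_empty] at h0
      subst h0
      rw [Finset.coe_empty, Set.empty_union] at hE
      have hmin : maximalIdeal R ∈ (Ideal.span (↑C : Set R)).minimalPrimes := by
        rw [← Ideal.radical_minimalPrimes, hE, Ideal.minimalPrimes_eq_subsingleton_self]
        exact Set.mem_singleton _
      exact ne_maximalIdeal_of_mem_minimalPrimes hd C hCd hmin rfl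
    obtain ⟨a, ha⟩ := hne A hradA
    obtain ⟨b, hb⟩ := hne B hradB
    set A' := A.erase a with hA'
    set B' := B.erase b with hB'
    have hA'c : A'.card ≤ n := by
      rw [hA', Finset.card_erase_of_mem ha]; omega
    have hB'c : B'.card ≤ n := by
      rw [hB', Finset.card_erase_of_mem hb]; omega
    -- the two `d`-element sub-ideals
    set D₁ : Finset R := A' ∪ C with hD₁
    set D₂ : Finset R := B' ∪ C with hD₂
    have hD₁c : D₁.card ≤ d := (Finset.card_union_le _ _).trans (by omega)
    have hD₂c : D₂.card ≤ d := (Finset.card_union_le _ _).trans (by omega)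
    have hAset : (↑A ∪ ↑C : Set R) = insert a (↑D₁ : Set R) := by
      rw [hD₁, Finset.coe_union, ← Set.insert_union, hA', ← Finset.coe_insert,
        Finset.insert_erase ha]
    have hBset : (↑B ∪ ↑C : Set R) = insert b (↑D₂ : Set R) := by
      rw [hD₂, Finset.coe_union, ← Set.insert_union, hB', ← Finset.coe_insert,
        Finset.insert_erase hb]
    rw [hAset] at hradA hfc
    rw [hBset] at hradB ⊢
    -- a common parameter `w`
    obtain ⟨w, hwm, hw₁, hw₂⟩ :=
      exists_mem_maximalIdeal_radical_eq_and hd D₁ D₂ hD₁c hD₂c hradA hradB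
    -- move `a ↦ w`
    have h1 : IsFrobeniusClosed p (Ideal.span (insert w (↑D₁ : Set R))) :=
      isFrobeniusClosed_move_finset p hCM hd D₁ hD₁c hradA hw₁ hfc
    -- recurse with `C' = C ∪ {w}`
    have hC'c : (insert w C).card + n ≤ d + 1 := (Nat.add_le_add_right (Finset.card_insert_le _ _) n).trans (by omega)
    have hset₁ : (↑A' ∪ ↑(insert w C) : Set R) = insert w (↑D₁ : Set R) := by
      rw [Finset.coe_insert, Set.union_insert, hD₁, Finset.coe_union]
    have hset₂ : (↑B' ∪ ↑(insert w C) : Set R) = insert w (↑D₂ : Set R) := by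
      rw [Finset.coe_insert, Set.union_insert, hD₂, Finset.coe_union]
    have h2 : IsFrobeniusClosed p (Ideal.span (insert w (↑D₂ : Set R))) := by
      have h := ih A' B' (insert w C) hA'c hB'c hC'c (by rw [hset₁]; exact hw₁)
        (by rw [hset₂]; exact hw₂) (by rw [hset₁]; exact h1)
      rwa [hset₂] at h
    -- move `w ↦ b`
    exact isFrobeniusClosed_move_finset p hCM hd D₂ hD₂c hw₂ hradB h2

/-- **One Frobenius closed parameter ideal ⇒ all** (Cohen–Macaulay local rings). Let `(R, 𝔪)` be a
Noetherian local ring of prime characteristic `p` in which every system of parameters is a weakly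
regular sequence. If the ideal generated by ONE system of parameters `s` is Frobenius closed, then the
ideal generated by EVERY system of parameters `t` is Frobenius closed. (For Cohen–Macaulay rings this is
the ideal-theoretic form of Fedder's "F-injective ⇔ all parameter ideals Frobenius closed"; no local
cohomology is used.) [cite: Fedder1983, Prop. 1.10 and Thm. 1.12; QuyShimomoto2017 §3] -/
theorem isFrobeniusClosed_of_isFrobeniusClosed_sop (p : ℕ) [Fact p.Prime] [IsNoetherianRing R]
    [IsLocalRing R] [CharP R p]
    (hCM : ∀ ⦃n : ℕ⦄ (s : Fin n → R), IsSystemOfParameters s → IsWeaklyRegular R (List.ofFn s))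
    {n : ℕ} {s t : Fin n → R} (hs : IsSystemOfParameters s) (ht : IsSystemOfParameters t)
    (hfc : IsFrobeniusClosed p (Ideal.span (Set.range s))) :
    IsFrobeniusClosed p (Ideal.span (Set.range t)) := by
  classical
  rcases n with _ | d
  · have h0 : Set.range t = Set.range s := by
      rw [Set.range_eq_empty, Set.range_eq_empty]
    rwa [h0]
  · have hd : ringKrullDim R = ((d + 1 : ℕ) : WithBot ℕ∞) := hs.1
    have hset : ∀ v : Fin (d + 1) → R,
        (↑(Finset.univ.image v) ∪ ↑(∅ : Finset R) : Set R) = Set.range v := by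
      intro v
      rw [Finset.coe_image, Finset.coe_univ, Set.image_univ, Finset.coe_empty, Set.union_empty]
    have h := isFrobeniusClosed_transfer_aux p hCM hd (d + 1) (Finset.univ.image s)
      (Finset.univ.image t) ∅
      (Finset.card_image_le.trans (by simp)) (Finset.card_image_le.trans (by simp)) (by simp)
      (by rw [hset]; exact hs.2) (by rw [hset]; exact ht.2) (by rw [hset]; exact hfc)
    rwa [hset] at h

end Literature.RingTheory.TightClosure.CMFILocalization.OneSop

end Part8

/-!
## Part 9 — port of `Summits/ResolutionOfSingularities/ResolutionOfSingularities/Theorems/FrobeniusLadderFInjectiveMacaulayficationPartialSop.lean` (1 declarations kept)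

# Initial segments of a system of parameters generate Frobenius closed ideals

Let `(R, 𝔪)` be a Noetherian local ring of prime characteristic `p` in which every system of parameters `u` is a weakly
regular sequence and generates a Frobenius closed ideal.  Then every INITIAL SEGMENT `s` of a system of parameters
`Fin.append s t` generates a Frobenius closed ideal (`isFrobeniusClosed_span_range_of_append`): with `I = (s)` and
`J_n = (s, tⁿ)` (again a parameter ideal), `I^F ⊆ J_n^F = J_n ⊆ I + 𝔪ⁿ`, so `I^F ⊆ ⋂ₙ (I + 𝔪ⁿ) = I` by Krull's intersection
theorem in `R/I`.  References: P. H. Quy, K. Shimomoto, *F-injectivity and Frobenius closure of ideals in Noetherian rings of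
characteristic p > 0*, Adv. Math. 313 (2017) §3 [QuyShimomoto2017]; M. Hochster, C. Huneke, Trans. AMS 346 (1994) Thm. 4.2 (c)
(the tight-closure original).
-/

section Part9

open Literature.RingTheory.TightClosure _root_.IsLocalRing

namespace Literature.RingTheory.TightClosure.CMFILocalization.PartialSop

/-- **The ideal of an initial segment of a system of parameters is Frobenius closed** (in a Noetherian
local ring of prime characteristic `p` all of whose parameter ideals are Frobenius closed and all of
whose systems of parameters are weakly regular).  If `Fin.append s t` is a system of parameters, then
`(s)^F ⊆ ⋂ₙ (s, tⁿ) ⊆ ⋂ₙ ((s) + 𝔪ⁿ) = (s)`: each `(s, tⁿ)`, `n ≥ 1`, is again a parameter ideal,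
hence Frobenius closed, and the last equality is Krull's intersection theorem in `R/(s)` (the
Frobenius-closure twin of Hochster–Huneke 1994, Thm. 4.2 (c); cf. Quy–Shimomoto 2017, §3).
[cite: QuyShimomoto2017, §3 (initial segments of a system of parameters generate Frobenius closed ideals; Krull intersection)] -/
theorem isFrobeniusClosed_span_range_of_append (p : ℕ) [Fact p.Prime] (R : Type uR) [CommRing R]
    [IsNoetherianRing R] [IsLocalRing R] [CharP R p]
    (hR : ∀ ⦃n : ℕ⦄ (u : Fin n → R), IsSystemOfParameters u →
        RingTheory.Sequence.IsWeaklyRegular R (List.ofFn u) ∧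
          IsFrobeniusClosed p (Ideal.span (Set.range u)))
    {d e : ℕ} (s : Fin d → R) (t : Fin e → R) (hst : IsSystemOfParameters (Fin.append s t)) :
    IsFrobeniusClosed p (Ideal.span (Set.range s)) := by
  obtain ⟨hd, hrad⟩ := hst
  -- every parameter lies in `𝔪 = rad (s, t)`
  have hsm : ∀ i, s i ∈ maximalIdeal R := fun i => by
    rw [← hrad]
    exact Ideal.le_radical (Ideal.subset_span ⟨Fin.castAdd e i, Fin.append_left s t i⟩)
  have htm : ∀ j, t j ∈ maximalIdeal R := fun j => by
    rw [← hrad]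
    exact Ideal.le_radical (Ideal.subset_span ⟨Fin.natAdd d j, Fin.append_right s t j⟩)
  set I : Ideal R := Ideal.span (Set.range s)
  have hIm : I ≤ maximalIdeal R := by
    refine Ideal.span_le.mpr ?_
    rintro _ ⟨i, rfl⟩
    exact hsm i
  rw [isFrobeniusClosed_iff_le]
  intro y hy
  -- `y ∈ I + 𝔪ⁿ` for every `n ≥ 1`, via the system of parameters `(s, tⁿ)`
  have hyn : ∀ n : ℕ, 0 < n → y ∈ I ⊔ maximalIdeal R ^ n := by
    intro n hn
    -- the modified system of parameters
    let s' : Fin (d + e) → R := Fin.append s fun j => t j ^ n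
    have hs'_left : ∀ i, s' (Fin.castAdd e i) = s i := fun i => Fin.append_left _ _ i
    have hs'_right : ∀ j, s' (Fin.natAdd d j) = t j ^ n := fun j => Fin.append_right _ _ j
    set J : Ideal R := Ideal.span (Set.range s')
    have hsop : IsSystemOfParameters s' := by
      refine ⟨hd, le_antisymm ?_ ?_⟩
      · -- `rad J ≤ 𝔪` since `J ≤ 𝔪`
        refine (maximalIdeal.isMaximal R).isPrime.radical_le_iff.mpr (Ideal.span_le.mpr ?_)
        rintro _ ⟨i, rfl⟩
        induction i using Fin.addCases with
        | left i =>
          rw [hs'_left]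
          exact hsm i
        | right j =>
          rw [hs'_right]
          exact Ideal.pow_mem_of_mem _ (htm j) n hn
      · -- `𝔪 = rad (s, t) ≤ rad J` since `(s, t) ≤ rad J`
        rw [← hrad]
        refine Ideal.radical_le_radical_iff.mpr (Ideal.span_le.mpr ?_)
        rintro _ ⟨i, rfl⟩
        induction i using Fin.addCases with
        | left i =>
          rw [Fin.append_left]
          exact Ideal.le_radical (Ideal.subset_span ⟨Fin.castAdd e i, hs'_left i⟩)
        | right j =>
          rw [Fin.append_right]
          exact ⟨n, Ideal.subset_span ⟨Fin.natAdd d j, hs'_right j⟩⟩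
    have hJ' : IsFrobeniusClosed p J := (hR s' hsop).2
    have hIJ : I ≤ J := by
      refine Ideal.span_le.mpr ?_
      rintro _ ⟨i, rfl⟩
      exact Ideal.subset_span ⟨Fin.castAdd e i, hs'_left i⟩
    have hyJ : y ∈ J := hJ'.le (frobeniusClosure_mono p hIJ hy)
    refine (Ideal.span_le.mpr ?_ : J ≤ I ⊔ maximalIdeal R ^ n) hyJ
    rintro _ ⟨i, rfl⟩
    induction i using Fin.addCases with
    | left i =>
      rw [hs'_left]
      exact Ideal.mem_sup_left (Ideal.subset_span ⟨i, rfl⟩)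
    | right j =>
      rw [hs'_right]
      exact Ideal.mem_sup_right (Ideal.pow_mem_pow (htm j) n)
  -- Krull's intersection theorem in `R/I`
  have hItop : I ≠ ⊤ := fun h => (maximalIdeal.isMaximal R).ne_top (top_le_iff.mp (h ▸ hIm))
  haveI : Nontrivial (R ⧸ I) := Ideal.Quotient.nontrivial_iff.mpr hItop
  haveI : IsLocalRing (R ⧸ I) :=
    IsLocalRing.of_surjective' (Ideal.Quotient.mk I) Ideal.Quotient.mk_surjective
  have hmk : (maximalIdeal R).map (Ideal.Quotient.mk I) = maximalIdeal (R ⧸ I) :=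
    IsLocalRing.map_maximalIdeal_of_surjective _ Ideal.Quotient.mk_surjective
  have hbar : Ideal.Quotient.mk I y ∈ ⨅ n : ℕ, maximalIdeal (R ⧸ I) ^ n := by
    refine Ideal.mem_iInf.mpr fun n => ?_
    rcases Nat.eq_zero_or_pos n with rfl | hn
    · rw [pow_zero, Ideal.one_eq_top]
      trivial
    have := Ideal.mem_map_of_mem (Ideal.Quotient.mk I) (hyn n hn)
    rw [Ideal.map_sup, Ideal.map_quotient_self, bot_sup_eq, Ideal.map_pow, hmk] at this
    exact this
  rw [Ideal.iInf_pow_eq_bot_of_isLocalRing _ (maximalIdeal.isMaximal (R ⧸ I)).ne_top,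
    Ideal.mem_bot, Ideal.Quotient.eq_zero_iff_mem] at hbar
  exact hbar

end Literature.RingTheory.TightClosure.CMFILocalization.PartialSop

end Part9

/-!
## Part 10 — port of `Summits/ResolutionOfSingularities/ResolutionOfSingularities/Theorems/FrobeniusLadderFInjectiveMacaulayficationFrobeniusClosedLocalizes.lean` (5 declarations kept)

# Frobenius-closedness of parameter ideals localizes

Let `(R, 𝔪)` be a Noetherian local ring of prime characteristic `p` in which every system of parameters is a weakly regular
sequence and generates a Frobenius closed ideal; `P` a prime; `Fin.append x t` a system of parameters whose head `x` (of
length `ht P`) lies in `P` with `P` minimal over `(x)`; and suppose every system of parameters of `R_P` is weakly regular.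
Then every ideal of `R_P` generated by a system of parameters is Frobenius closed (`stub_frobeniusClosedLocalizes`, historical
name kept; inline form `y^q ∈ (u)^[q] ⇒ y ∈ (u)`).  Proof: `(x)` is Frobenius closed in `R` (previous Part);
Frobenius-closedness passes to localizations (`isFrobeniusClosed_map_of_isLocalization`: `c·y^q ∈ I^[q]`, `c ∈ M` ⇒
`(c y)^q ∈ I^[q]` ⇒ `c y ∈ I`); the images of `x` form a system of parameters of `R_P` (`isSystemOfParameters_algebraMap`,
`charP_localizationAtPrime`, `span_range_algebraMap`); and one Frobenius closed parameter ideal of a Cohen–Macaulay local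
ring makes all of them so.  This is the F-injectivity half of Hashimoto 2010 Cor. 4.7 in the clause form of Lemma 4.1,
proved ideal-theoretically (the printed proofs — Hashimoto via the Γ-construction and openness of the CMFI locus,
Datta–Murayama via local cohomology — are not followed).  References: M. Hashimoto, *F-pure homomorphisms, strong
F-regularity, and F-injectivity*, Comm. Algebra 38 (2010), Cor. 4.7, Lemma 4.1 [Hashimoto2010]; [QuyShimomoto2017, §3];
[Fedder1983, Thm. 1.12].
-/

section Part10

open Literature.RingTheory.TightClosure _root_.IsLocalRing

namespace Literature.RingTheory.TightClosure.CMFILocalization.FrobeniusClosedLocalizes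

/-! ## §1 Frobenius closure under localization -/

/-- **Frobenius-closedness localizes**: if `I` is a Frobenius closed ideal of `A` and `S = M⁻¹A` is a
localization (both of exponential characteristic `p`), then `I S` is Frobenius closed.  For
`z = y/w` with `z^q ∈ (I S)^[q] = I^[q] S` one finds `c ∈ M` with `c y^q ∈ I^[q]`; then
`(c y)^q = c^(q-1) (c y^q) ∈ I^[q]`, so `c y ∈ I` and `z = (c y)/(c w) ∈ I S`. [cite: Hashimoto2010, Cor. 4.7 with Lemma 4.1 (Frobenius-closedness of parameter ideals passes to R_P)] -/
theorem isFrobeniusClosed_map_of_isLocalization {A : Type*} [CommRing A] (M : Submonoid A)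
    (S : Type*) [CommRing S] [Algebra A S] [IsLocalization M S] (p : ℕ) [ExpChar A p] [ExpChar S p]
    {I : Ideal A} (hI : IsFrobeniusClosed p I) :
    IsFrobeniusClosed p (I.map (algebraMap A S)) := by
  rw [isFrobeniusClosed_iff_le]
  rintro z ⟨e, hz⟩
  rw [Fedder.frobeniusPower_map] at hz
  obtain ⟨y, w, rfl⟩ := IsLocalization.exists_mk'_eq M z
  rw [← IsLocalization.mk'_pow, IsLocalization.mk'_mem_map_algebraMap_iff M] at hz
  obtain ⟨c, hcM, hc⟩ := hz
  rw [IsLocalization.mk'_mem_map_algebraMap_iff M]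
  refine ⟨c, hcM, hI.le ⟨e, ?_⟩⟩
  have hq : p ^ e ≠ 0 := (expChar_pow_pos A p e).ne'
  have key : (c * y) ^ p ^ e = c ^ (p ^ e - 1) * (c * y ^ p ^ e) := by
    rw [mul_pow, ← mul_assoc, pow_sub_one_mul hq]
  rw [key]
  exact Ideal.mul_mem_left _ _ hc

/-! ## §2 The local ring `R_P`: characteristic and a system of parameters through `P` -/

/-- `R_P` has characteristic `p` if `R` has (`p · 1 = 0` is preserved by `algebraMap`, and `R_P` is a
nontrivial local ring). [cite: Hashimoto2010, Cor. 4.7 with Lemma 4.1 (Frobenius-closedness of parameter ideals passes to R_P)] -/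
theorem charP_localizationAtPrime {R : Type*} [CommRing R] (p : ℕ) [Fact p.Prime] [CharP R p]
    (P : Ideal R) [P.IsPrime] : CharP (Localization.AtPrime P) p := by
  have hp : (p : Localization.AtPrime P) = 0 := by
    rw [← map_natCast (algebraMap R (Localization.AtPrime P)) p, CharP.cast_eq_zero, map_zero]
  exact (CharP.charP_iff_prime_eq_zero Fact.out).mpr hp

/-- The ideal of `R_P` generated by the images of `x` is the extension `(x) R_P`. [cite: Hashimoto2010, Cor. 4.7 with Lemma 4.1 (Frobenius-closedness of parameter ideals passes to R_P)] -/
theorem span_range_algebraMap {R : Type*} [CommRing R] (S : Type*) [CommRing S] [Algebra R S]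
    {h : ℕ} (x : Fin h → R) :
    Ideal.span (Set.range fun i => algebraMap R S (x i)) =
      (Ideal.span (Set.range x)).map (algebraMap R S) := by
  rw [Ideal.map_span, ← Set.range_comp]
  rfl

/-- **A system of parameters of `R_P` coming from `R`.**  If `P` is a prime of height `h` minimal over
the ideal `(x)` generated by `h` elements, then the images of `x` in `R_P` form a system of parameters:
`dim R_P = ht P = h` and `rad ((x) R_P) = P R_P` is the maximal ideal. [cite: Hashimoto2010, Cor. 4.7 with Lemma 4.1 (Frobenius-closedness of parameter ideals passes to R_P)] -/
theorem isSystemOfParameters_algebraMap {R : Type*} [CommRing R] (P : Ideal R) [P.IsPrime]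
    {h : ℕ} (x : Fin h → R) (hPmin : P ∈ (Ideal.span (Set.range x)).minimalPrimes)
    (hPh : P.height = h) :
    IsSystemOfParameters (fun i => algebraMap R (Localization.AtPrime P) (x i)) := by
  refine ⟨?_, ?_⟩
  · rw [IsLocalization.AtPrime.ringKrullDim_eq_height P (Localization.AtPrime P), hPh]
    rfl
  · rw [span_range_algebraMap,
      IsLocalization.AtPrime.radical_map_of_mem_minimalPrimes (Localization.AtPrime P) P _ hPmin,
      Localization.AtPrime.map_eq_maximalIdeal]

/-! ## §3 Frobenius-closedness of parameter ideals passes to `R_P` -/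

/-- **Frobenius-closedness of parameter ideals localizes** (`stub_frobeniusClosedLocalizes`, historical name
kept).  Let `(R, 𝔪)` be a Noetherian local ring of characteristic `p` all of whose systems
of parameters are weakly regular with Frobenius closed ideal, `P` a prime, `Fin.append x t` a system of
parameters of `R` with `x ⊆ P`, `P` minimal over `(x)` and `ht P = |x|`, and assume every system of
parameters of `R_P` is weakly regular.  Then every ideal of `R_P` generated by a system of parameters
`u` is Frobenius closed (inline form): `(x)` is Frobenius closed in `R`
(`PartialSop.isFrobeniusClosed_span_range_of_append`), hence `(x) R_P` is Frobenius closed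
(`isFrobeniusClosed_map_of_isLocalization`); the images of `x` form a system of parameters of `R_P`
(`isSystemOfParameters_algebraMap`); and one Frobenius closed parameter ideal of a Cohen–Macaulay
local ring makes all of them Frobenius closed (`OneSop.isFrobeniusClosed_of_isFrobeniusClosed_sop`).
[cite: Hashimoto2010, Cor. 4.7 with Lemma 4.1 (Frobenius-closedness of parameter ideals passes to R_P)] -/
theorem stub_frobeniusClosedLocalizes : ∀ (p : ℕ) [Fact p.Prime] (R : Type uR) [CommRing R]
    [IsNoetherianRing R] [IsLocalRing R] [CharP R p],
    (∀ ⦃n : ℕ⦄ (u : Fin n → R), Literature.RingTheory.TightClosure.IsSystemOfParameters u →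
        RingTheory.Sequence.IsWeaklyRegular R (List.ofFn u) ∧
        Literature.RingTheory.TightClosure.IsFrobeniusClosed p (Ideal.span (Set.range u))) →
    ∀ (P : Ideal R) [P.IsPrime] (h e : ℕ) (x : Fin h → R) (t : Fin e → R),
      Literature.RingTheory.TightClosure.IsSystemOfParameters (Fin.append x t) → (∀ i, x i ∈ P) →
      P ∈ (Ideal.span (Set.range x)).minimalPrimes → P.height = h →
      (∀ ⦃n : ℕ⦄ (u : Fin n → Localization.AtPrime P),
        Literature.RingTheory.TightClosure.IsSystemOfParameters u →
        RingTheory.Sequence.IsWeaklyRegular (Localization.AtPrime P) (List.ofFn u)) →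
      ∀ ⦃n : ℕ⦄ (u : Fin n → Localization.AtPrime P),
        Literature.RingTheory.TightClosure.IsSystemOfParameters u →
        ∀ y : Localization.AtPrime P, (∃ e : ℕ, y ^ p ^ e ∈ Ideal.span
          ((fun z : Localization.AtPrime P => z ^ p ^ e) ''
            (Ideal.span (Set.range u) : Set (Localization.AtPrime P)))) → y ∈ Ideal.span (Set.range u) := by
  intro p _ R _ _ _ _ hR P _ h e x t hxt _hxP hPmin hPh hCMP n u hu
  haveI : CharP (Localization.AtPrime P) p := charP_localizationAtPrime p P
  -- (1) `(x)` is Frobenius closed in `R`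
  have hfcx : IsFrobeniusClosed p (Ideal.span (Set.range x)) :=
    PartialSop.isFrobeniusClosed_span_range_of_append p R hR x t hxt
  -- (2) `(x) R_P` is Frobenius closed in `R_P`
  have hfcx' : IsFrobeniusClosed p
      (Ideal.span (Set.range fun i => algebraMap R (Localization.AtPrime P) (x i))) := by
    rw [span_range_algebraMap]
    exact isFrobeniusClosed_map_of_isLocalization P.primeCompl (Localization.AtPrime P) p hfcx
  -- (3) the images of `x` form a system of parameters of `R_P`
  have hx' : IsSystemOfParameters (fun i => algebraMap R (Localization.AtPrime P) (x i)) :=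
    isSystemOfParameters_algebraMap P x hPmin hPh
  -- (4) `n = h`, and one Frobenius closed parameter ideal makes all of them Frobenius closed
  obtain rfl : n = h := by
    have h1 := hu.1
    rw [hx'.1] at h1
    exact_mod_cast h1.symm
  exact (isFrobeniusClosed_iff p).mp
    (OneSop.isFrobeniusClosed_of_isFrobeniusClosed_sop p hCMP hx' hu hfcx')

end Literature.RingTheory.TightClosure.CMFILocalization.FrobeniusClosedLocalizes

end Part10

/-!
## Part 11 — port of `Summits/ResolutionOfSingularities/ResolutionOfSingularities/Theorems/FrobeniusLadderFInjectiveMacaulayficationClauseLocalizes.lean` (2 declarations kept)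

# The Cohen–Macaulay + F-injective clause localizes (Hashimoto 2010 Cor. 4.7 in the clause form of Lemma 4.1)

If a Noetherian local ring `R` of prime characteristic `p` has every system of parameters weakly regular with Frobenius
closed ideal — "CMFI" in the clause form of Hashimoto 2010 Lemma 4.1 ((R CM) ∧ every parameter ideal Frobenius closed) —
then so does `R_P` for every prime `P` (`clause_localization`; `sopClause_of_inline` converts the inline clause into the
`IsSystemOfParameters` form).  Assembly of the previous Parts: `P` is minimal over the head `x ⊆ P` of a system of
parameters; `x` is `R`-regular hence `R_P`-regular of length `ht P = dim R_P`, so `R_P` is Cohen–Macaulay; `(x)` is Frobenius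
closed in `R`, hence `(x)R_P` is; and one Frobenius closed parameter ideal of a Cohen–Macaulay local ring makes all of them
so.  Ideal-theoretic proof, no local cohomology.  References: M. Hashimoto, Comm. Algebra 38 (2010) 4569–4596
(arXiv:0908.2703), §4 Cor. 4.7 («Let (R, 𝔪) be a noetherian local CMFI ring of characteristic p. Then for any prime ideal P
of R, R_P is CMFI.»), Lemma 4.1 [Hashimoto2010]; [QuyShimomoto2017, §3]; R. Datta, T. Murayama, *Permanence properties of
F-injectivity* (2020) Prop. 3.3; [Matsumura1987, Thm 17.3 (iii)].
-/

section Part11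

namespace Literature.RingTheory.TightClosure.CMFILocalization.ClauseLocalizes

open _root_.IsLocalRing RingTheory.Sequence Literature.RingTheory.TightClosure

variable (p : ℕ) [Fact p.Prime]

/-- Inline form of the clause ⇒ `IsSystemOfParameters`/`IsFrobeniusClosed` form. [folklore] -/
private theorem sopClause_of_inline {L : Type uR} [CommRing L] [IsLocalRing L] [CharP L p]
    (h : ∀ d : ℕ, ringKrullDim L = d → ∀ s : Fin d → L, (Ideal.span (Set.range s)).radical.IsMaximal →
      IsWeaklyRegular L (List.ofFn s) ∧
      ∀ y : L, (∃ e : ℕ, y ^ p ^ e ∈ Ideal.span ((fun z : L => z ^ p ^ e) ''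
        (Ideal.span (Set.range s) : Set L))) → y ∈ Ideal.span (Set.range s)) :
    ∀ ⦃n : ℕ⦄ (u : Fin n → L), IsSystemOfParameters u →
      IsWeaklyRegular L (List.ofFn u) ∧ IsFrobeniusClosed p (Ideal.span (Set.range u)) := by
  intro n u hu
  obtain ⟨hd, hrad⟩ := (isSystemOfParameters_iff).mp hu
  obtain ⟨hW, hF⟩ := h n hd u hrad
  exact ⟨hW, (isFrobeniusClosed_iff p).mpr hF⟩

/-- **THE CMFI CLAUSE LOCALIZES (Hashimoto 2010 Cor. 4.7, clause form).** If a Noetherian local ring `R` of prime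
characteristic `p` satisfies the clause (every system of parameters is weakly regular and generates a Frobenius closed ideal — i.e.
`R` is Cohen–Macaulay and F-injective, Quy–Shimomoto), then so does its localization `R_P` at every prime
`P`. Ideal-theoretic proof (no local cohomology): `P` is minimal over the head `x ⊆ P` of a system of
parameters (`stub_sopThroughPrime`); `x` is `R`-regular hence `R_P`-regular of length `ht P = dim R_P`, so
`R_P` is Cohen–Macaulay (`stub_cmLocalizes`); `(x)` is Frobenius closed in `R`, hence `(x)R_P` is, and one
Frobenius closed parameter ideal of the Cohen–Macaulay ring `R_P` makes all of them so
(`stub_frobeniusClosedLocalizes`).  (Cf. Datta–Murayama 2020 Prop. 3.3: F-injectivity localizes, via local cohomology;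
Matsumura Thm. 17.3 (iii).)
[cite: Hashimoto2010, Cor. 4.7 (a noetherian local CMFI ring of characteristic p has all R_P CMFI) with Lemma 4.1] -/
theorem clause_localization {R : Type uR} [CommRing R] [IsNoetherianRing R] [IsLocalRing R] [CharP R p]
    (hR : ∀ d : ℕ, ringKrullDim R = d → ∀ s : Fin d → R, (Ideal.span (Set.range s)).radical.IsMaximal →
      IsWeaklyRegular R (List.ofFn s) ∧
      ∀ y : R, (∃ e : ℕ, y ^ p ^ e ∈ Ideal.span ((fun z : R => z ^ p ^ e) ''
        (Ideal.span (Set.range s) : Set R))) → y ∈ Ideal.span (Set.range s))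
    (P : Ideal R) [P.IsPrime] :
    ∀ d : ℕ, ringKrullDim (Localization.AtPrime P) = d → ∀ s : Fin d → Localization.AtPrime P,
      (Ideal.span (Set.range s)).radical.IsMaximal →
      IsWeaklyRegular (Localization.AtPrime P) (List.ofFn s) ∧
      ∀ y : Localization.AtPrime P, (∃ e : ℕ, y ^ p ^ e ∈ Ideal.span
        ((fun z : Localization.AtPrime P => z ^ p ^ e) ''
          (Ideal.span (Set.range s) : Set (Localization.AtPrime P)))) → y ∈ Ideal.span (Set.range s) := by
  have hsop := sopClause_of_inline p hR
  have hCM : ∀ ⦃n : ℕ⦄ (u : Fin n → R), IsSystemOfParameters u → IsWeaklyRegular R (List.ofFn u) :=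
    fun n u hu => (hsop u hu).1
  obtain ⟨h, e, x, t, hxt, hxP, hmin, hht⟩ := SopThroughPrime.stub_sopThroughPrime R P
  have hCMP := CmLocalizes.stub_cmLocalizes R hCM P h e x t hxt hxP hmin hht
  have hFCP := FrobeniusClosedLocalizes.stub_frobeniusClosedLocalizes p R hsop P h e x t hxt hxP hmin hht hCMP
  intro n hn u hrad
  have hu : IsSystemOfParameters u := isSystemOfParameters_iff.mpr ⟨hn, hrad⟩
  exact ⟨hCMP u hu, hFCP u hu⟩

end Literature.RingTheory.TightClosure.CMFILocalization.ClauseLocalizes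

end Part11

/-! ## Part 12 — the EXACT, universe-polymorphic discharge `Hashimoto2010_cmfiLocalizes_holds` -/

namespace Literature.RingTheory.TightClosure

/-- **The named fact `Hashimoto2010_cmfiLocalizes` HOLDS, at every universe** (`CMFILocalizes.lean`; Hashimoto 2010 Cor. 4.7 in the
clause form of Lemma 4.1: for a Noetherian local ring of characteristic `p`, "every system of parameters weakly regular ∧ every
parameter ideal Frobenius closed" passes to `R_P` for every prime `P`).  EXACT-name discharge; proof =
`CMFILocalization.ClauseLocalizes.clause_localization` with the clause pair split (ideal-theoretic; the printed proof via the
Γ-construction is not followed); Literature-side twin of the in-tree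
`Summit.ResolutionOfSingularities.ResolutionOfSingularities.Theorems.FInjectiveMacaulayfication.CMFILocalizesHolds.hashimoto2010_cmfiLocalizes_holds`
(there at universe `0`). [cite: Hashimoto2010, Cor. 4.7; Lemma 4.1] -/
theorem Hashimoto2010_cmfiLocalizes_holds : Hashimoto2010_cmfiLocalizes.{uR} := by
  intro p _ R _ _ _ _ hR P _
  have hmerged : ∀ d : ℕ, ringKrullDim R = d → ∀ s : Fin d → R, (Ideal.span (Set.range s)).radical.IsMaximal →
      RingTheory.Sequence.IsWeaklyRegular R (List.ofFn s) ∧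
      ∀ y : R, (∃ e : ℕ, y ^ p ^ e ∈ Ideal.span ((fun z : R => z ^ p ^ e) '' (Ideal.span (Set.range s) : Set R))) →
        y ∈ Ideal.span (Set.range s) :=
    fun d hd s hs => ⟨hR.1 d hd s hs, hR.2 d hd s hs⟩
  have h := CMFILocalization.ClauseLocalizes.clause_localization p hmerged P
  exact ⟨fun d hd s hs => (h d hd s hs).1, fun d hd s hs => (h d hd s hs).2⟩

end Literature.RingTheory.TightClosure

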